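import Mathlib
import Literature.Analysis.FluidPDE.GalerkinFlow
import HarnessLib

/-!
# Birth skeleton of piece P1 `RobustLoudLowBlocks` (tail-lift split of crux stmt-AnomalousDissipation-10352) — REFRESHED:
# S2 `BoxExtensionUpward` PROVED in-file, single open stub S1 `StructuralBlockAtSweepingScale` (§STUBS at the end)
# (crux-strategist r1, 2026-08-17)

Sorry-free; axioms `propext`, `Classical.choice`, `Quot.sound`.

## What is proved

* `stub_boxExtensionUpward` (S2 of `Lines/RobustLoudLowBlocksBirth.lean`, verbatim): a robust loud polyfacial block of the
  ORDER-`m₀` Galerkin system at an explicit sweeping level `m₀` — `10⁵ A ≤ ν (m₀+1)`, `10⁴ A² θ^{2m₀} ≤ δ`, `mf ≤ m₀` — with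
  DOUBLED robustness (`2 ×` the coupling majorant `ν A θ^{max(|k|₁,m₀)}(1+max)^{-4}`) and DOUBLED window slack (`2δ`) extends
  to EVERY level `m ≥ m₀` as a block with the plain majorant / slack of piece P1: old faces `h i ∘ P` (`P` = restriction to
  `|k| ≤ m₀`) plus the per-mode Gevrey boxes `prof(k)² − ‖y k‖²` for the shell `m₀² < |k|² ≤ m²`.
* `robustLoudLowBlocks_of_structuralBlock : S1 → P1` (`m := max M m₀`): the piece P1 `RobustLoudLowBlocks` (verbatim the route
  leaf-to-be / registered stub `stub_robustLoudLowBlocks` of line `TailLift`) follows from S1 ALONE — ONE robust loud block per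
  viscosity at the explicit sweeping level.  With `Lines/TailLiftSplit.lean` (`P1 → UniformGalerkinTrap`, proved) the crux
  `UniformGalerkinTrap` follows from S1; S1 is the honest open core (the constructive zeroth law at Galerkin level: one
  finite-dimensional certificate per `ν`, no `N`, no `∀ m`).

## Proof

* PART A = the tail estimates of `Lines/TailEstimates.lean` §1–§7 (lattice constant `C`, key weighted sum, convection bounds,
  quantitative entrance `re_inner_field_le` + `sweeping_ineq`, tail sums, coupling clause) — copied (workfiles are not importable).
* PART B: `C ≤ 13` — `∑_{n∈ℤ}(1+|n|)^{-2} = π²/3 − 1 ≤ 2.31` from `hasSum_zeta_two` and `π < 3.15`; so the explicit constants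
  dominate the thresholds: `576·C·A < π ν (m₀+1)` (shell robustness), `768 π C A ≤ ν (m₀+1)` (coupling), `½·C ≤ 10⁴`,
  `4π²·C ≤ 10⁴` (shell energy / enstrophy).
* PART C = generic lemmas and level maps of `Lines/TailLiftSplit.lean` PART II §1–§2 (`relabel`, `relabelPhase`,
  `not_retract_of_section`, sign constancy of affine functions).
* PART D: the extended faces (`extFace`/`extDeriv`; shell derivative = `fderiv` of `y ↦ ‖y k‖²`, value `−2Re⟪y k, v k⟫`,
  continuity by `ContDiff`), their clauses: restriction lands in the old block (L1), box (L2), actual coupling below the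
  level-`m₀` majorant (L3, `coupling_clause` with `(m, N) := (m₀, m)`), OLD faces robust (L4: coupling + perturbation `≤ 2 ×`
  majorant(`m₀`) by antitonicity `cpl_mono`), SHELL faces robust strict entrance (L5: `re_inner_field_le` + `|Re⟪y_k,w_k⟫| ≤
  ν(1+|k|₁)² prof²` via `cpl_le_prof`, and `shell_ineq`: `192πCA(1+L) + ν(1+L)² < 4π²νQ` from `576CA < πν(m₀+1)` and
  `12 < 2π²`), sign transfer with the doubled class (L6), NON-RETRACTION transfer along the zero-extension section (L7; a shell
  face is never an exit face), window with slack `δ` (L8); then re-indexing `Fin n ⊕ Fin #shell ≃ Fin (n + #shell)`.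
-/

noncomputable section

set_option linter.dupNamespace false

namespace Summit.AnomalousDissipation.AnomalousDissipation.Cruxes.UniformGalerkinTrap.RobustLoudLowBlocksBirth

open scoped InnerProductSpace ENNReal NNReal
open MeasureTheory Set Filter Topology
open Literature.Analysis.FunctionSpaces Literature.Analysis.FunctionSpaces.Torus
open Literature.Analysis.FluidPDE Literature.Analysis.FluidPDE.Torus

/-! # PART A — the tail estimates (copy of `Lines/TailEstimates.lean`, §1–§7; §8 not needed) -/


open scoped InnerProductSpace ENNReal NNReal
open MeasureTheory Set Filter Topology
open Literature.Analysis.FunctionSpaces Literature.Analysis.FunctionSpaces.Torus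
open Literature.Analysis.FluidPDE Literature.Analysis.FluidPDE.Torus

/-! ## §1 The ℓ¹ size of a frequency and elementary inequalities -/

/-- `|k|₁ = ∑ᵢ |kᵢ|` as a natural number. -/
def l1 (k : Fin 3 → ℤ) : ℕ := ∑ i, (k i).natAbs

theorem l1_nonneg_real (k : Fin 3 → ℤ) : (0 : ℝ) ≤ l1 k := Nat.cast_nonneg _

theorem cast_l1 (k : Fin 3 → ℤ) : ((l1 k : ℕ) : ℝ) = ∑ i, |((k i : ℤ) : ℝ)| := by
  unfold l1
  push_cast
  refine Finset.sum_congr rfl fun i _ => ?_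
  rw [Nat.cast_natAbs, Int.cast_abs]

theorem l1_neg (k : Fin 3 → ℤ) : l1 (-k) = l1 k := by
  unfold l1; simp

theorem l1_add_le (k l : Fin 3 → ℤ) : l1 (k + l) ≤ l1 k + l1 l := by
  unfold l1
  rw [← Finset.sum_add_distrib]
  exact Finset.sum_le_sum fun i _ => Int.natAbs_add_le _ _

theorem l1_sub_le (k l : Fin 3 → ℤ) : l1 (k - l) ≤ l1 k + l1 l := by
  have := l1_add_le k (-l)
  rwa [l1_neg, ← sub_eq_add_neg] at this

theorem l1_le_l1_sub_add (k l : Fin 3 → ℤ) : l1 k ≤ l1 (k - l) + l1 l := by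
  have := l1_add_le (k - l) l
  rwa [sub_add_cancel] at this

/-- `|k|₂² ≤ |k|₁²`. -/
theorem freqNormSq_le_l1_sq (k : Fin 3 → ℤ) : freqNormSq k ≤ ((l1 k : ℕ) : ℝ) ^ 2 := by
  rw [cast_l1, freqNormSq]
  have h : ∀ i, ((k i : ℤ) : ℝ) ^ 2 = |((k i : ℤ) : ℝ)| ^ 2 := fun i => (sq_abs _).symm
  simp_rw [h]
  exact Finset.sum_sq_le_sq_sum_of_nonneg fun i _ => abs_nonneg _

/-- `|k|₁² ≤ 3 |k|₂²` (Cauchy–Schwarz on three coordinates). -/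
theorem l1_sq_le_three_mul_freqNormSq (k : Fin 3 → ℤ) : ((l1 k : ℕ) : ℝ) ^ 2 ≤ 3 * freqNormSq k := by
  rw [cast_l1, freqNormSq, Fin.sum_univ_three, Fin.sum_univ_three]
  have h0 := sq_abs ((k 0 : ℤ) : ℝ); have h1 := sq_abs ((k 1 : ℤ) : ℝ); have h2 := sq_abs ((k 2 : ℤ) : ℝ)
  nlinarith [sq_nonneg (|((k 0 : ℤ) : ℝ)| - |((k 1 : ℤ) : ℝ)|), sq_nonneg (|((k 1 : ℤ) : ℝ)| - |((k 2 : ℤ) : ℝ)|),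
    sq_nonneg (|((k 0 : ℤ) : ℝ)| - |((k 2 : ℤ) : ℝ)|)]

/-- A frequency with `m² < |k|₂²` has `m + 1 ≤ |k|₁`. -/
theorem succ_le_l1_of_sq_lt {m : ℕ} {k : Fin 3 → ℤ} (h : ((m : ℕ) : ℝ) ^ 2 < freqNormSq k) : m + 1 ≤ l1 k := by
  have h2 : ((m : ℕ) : ℝ) ^ 2 < ((l1 k : ℕ) : ℝ) ^ 2 := h.trans_le (freqNormSq_le_l1_sq k)
  have h3 : (m : ℝ) < (l1 k : ℕ) := by
    exact lt_of_pow_lt_pow_left₀ 2 (Nat.cast_nonneg _) h2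
  exact_mod_cast h3

/-- A frequency in the ball `|k|₂² ≤ m²` has `|k|₁ ≤ 2 m` (indeed `≤ √3 m`). -/
theorem l1_le_two_mul_of_sq_le {m : ℕ} {k : Fin 3 → ℤ} (h : freqNormSq k ≤ ((m : ℕ) : ℝ) ^ 2) : l1 k ≤ 2 * m := by
  have h2 : ((l1 k : ℕ) : ℝ) ^ 2 ≤ 3 * ((m : ℕ) : ℝ) ^ 2 := (l1_sq_le_three_mul_freqNormSq k).trans (by linarith)
  have h3 : ((l1 k : ℕ) : ℝ) ^ 2 < ((2 * m + 1 : ℕ) : ℝ) ^ 2 := by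
    push_cast; nlinarith [Nat.cast_nonneg (α := ℝ) m]
  have h4 : ((l1 k : ℕ) : ℝ) < ((2 * m + 1 : ℕ) : ℝ) := lt_of_pow_lt_pow_left₀ 2 (Nat.cast_nonneg _) h3
  have h5 : l1 k < 2 * m + 1 := by exact_mod_cast h4
  omega

/-- Scalar part of the convection symbol: `|∑ⱼ cⱼ mⱼ| ≤ ‖c‖ |m|₁`. -/
theorem norm_sum_mul_le (c : EuclideanSpace ℂ (Fin 3)) (m : Fin 3 → ℤ) :
    ‖∑ j, c j * ((m j : ℤ) : ℂ)‖ ≤ ‖c‖ * ((l1 m : ℕ) : ℝ) := by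
  rw [cast_l1, Finset.mul_sum]
  refine (norm_sum_le _ _).trans (Finset.sum_le_sum fun j _ => ?_)
  rw [norm_mul, Complex.norm_intCast]
  exact mul_le_mul_of_nonneg_right (PiLp.norm_apply_le c j) (abs_nonneg _)

/-! ## §2 The lattice sum `∑ (1+|j|₁)^{-6}` is bounded uniformly over finite sets -/

/-- The one-dimensional majorant `(1+|n|)^{-2}` on `ℤ`. -/
def w1 (n : ℤ) : ℝ := ((1 + |(n : ℝ)|) ^ 2)⁻¹

theorem w1_nonneg (n : ℤ) : 0 ≤ w1 n := by unfold w1; positivity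

theorem summable_w1 : Summable w1 := by
  have h1 : Summable fun n : ℤ => 1 / (n : ℝ) ^ 2 := Real.summable_one_div_int_pow.2 one_lt_two
  have h2 : Summable fun n : ℤ => if n = 0 then (1 : ℝ) else 0 :=
    summable_of_ne_finset_zero (s := {0}) (by intro b hb; simp [Finset.mem_singleton] at hb; simp [hb])
  refine (h1.add h2).of_nonneg_of_le w1_nonneg fun n => ?_
  unfold w1
  by_cases hn : n = 0
  · subst hn; simp
  · simp only [hn, if_false, add_zero, one_div]
    have h0 : (0 : ℝ) < |(n : ℝ)| := by
      rw [abs_pos]; exact_mod_cast hn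
    rw [← sq_abs (n : ℝ)]
    exact inv_anti₀ (by positivity) (by nlinarith)

/-- The lattice constant `C = (∑_{n∈ℤ} (1+|n|)^{-2})³`. -/
def latC : ℝ := (∑' n : ℤ, w1 n) ^ 3

theorem latC_nonneg : 0 ≤ latC := pow_nonneg (tsum_nonneg w1_nonneg) 3

theorem sum_w1_le (s : Finset ℤ) : ∑ n ∈ s, w1 n ≤ ∑' n : ℤ, w1 n :=
  summable_w1.sum_le_tsum s fun n _ => w1_nonneg n

/-- `(1+|j|₁)³ ≥ ∏ᵢ (1+|jᵢ|)` (expand the cube). -/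
theorem prod_le_cube (j : Fin 3 → ℤ) : ∏ i, (1 + |((j i : ℤ) : ℝ)|) ≤ (1 + ((l1 j : ℕ) : ℝ)) ^ 3 := by
  rw [cast_l1, Fin.prod_univ_three, Fin.sum_univ_three]
  set a := |((j 0 : ℤ) : ℝ)|; set b := |((j 1 : ℤ) : ℝ)|; set c := |((j 2 : ℤ) : ℝ)|
  have ha : 0 ≤ a := abs_nonneg _; have hb : 0 ≤ b := abs_nonneg _; have hc : 0 ≤ c := abs_nonneg _
  nlinarith [mul_nonneg ha hb, mul_nonneg hb hc, mul_nonneg ha hc, mul_nonneg (mul_nonneg ha hb) hc,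
    mul_nonneg (mul_nonneg ha ha) ha, mul_nonneg (mul_nonneg hb hb) hb, mul_nonneg (mul_nonneg hc hc) hc,
    mul_nonneg (mul_nonneg ha ha) hb, mul_nonneg (mul_nonneg ha ha) hc, mul_nonneg (mul_nonneg hb hb) ha,
    mul_nonneg (mul_nonneg hb hb) hc, mul_nonneg (mul_nonneg hc hc) ha, mul_nonneg (mul_nonneg hc hc) hb]

/-- Pointwise: `(1+|j|₁)^{-6} ≤ ∏ᵢ (1+|jᵢ|)^{-2}`. -/
theorem inv_pow_six_le_prod (j : Fin 3 → ℤ) :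
    ((1 + ((l1 j : ℕ) : ℝ)) ^ 6)⁻¹ ≤ ∏ i, w1 (j i) := by
  have hp : ∏ i, w1 (j i) = ((∏ i, (1 + |((j i : ℤ) : ℝ)|)) ^ 2)⁻¹ := by
    unfold w1
    rw [Finset.prod_inv_distrib, ← Finset.prod_pow]
  rw [hp]
  have h0 : 0 < ∏ i, (1 + |((j i : ℤ) : ℝ)|) := Finset.prod_pos fun i _ => by positivity
  refine inv_anti₀ (by positivity) ?_
  calc (∏ i, (1 + |((j i : ℤ) : ℝ)|)) ^ 2 ≤ ((1 + ((l1 j : ℕ) : ℝ)) ^ 3) ^ 2 :=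
        pow_le_pow_left₀ h0.le (prod_le_cube j) 2
    _ = (1 + ((l1 j : ℕ) : ℝ)) ^ 6 := by ring

/-- **Uniform bound of the lattice sum**: for every finite `T ⊂ ℤ³`, `∑_{j∈T} (1+|j|₁)^{-6} ≤ C`. -/
theorem latticeSum_le (T : Finset (Fin 3 → ℤ)) :
    ∑ j ∈ T, ((1 + ((l1 j : ℕ) : ℝ)) ^ 6)⁻¹ ≤ latC := by
  classical
  -- a box containing T
  obtain ⟨R, hR⟩ : ∃ R : ℤ, ∀ j ∈ T, ∀ i, |j i| ≤ R := by
    refine ⟨∑ j ∈ T, ∑ i, |j i|, fun j hj i => ?_⟩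
    exact (Finset.single_le_sum (f := fun i => |j i|) (fun _ _ => abs_nonneg _) (Finset.mem_univ i)).trans
      (Finset.single_le_sum (f := fun j => ∑ i, |j i|) (fun _ _ => Finset.sum_nonneg fun _ _ => abs_nonneg _) hj)
  set box : Finset (Fin 3 → ℤ) := Fintype.piFinset fun _ : Fin 3 => Finset.Icc (-R) R with hbox
  have hT : T ⊆ box := by
    intro j hj
    rw [hbox, Fintype.mem_piFinset]
    intro i
    rw [Finset.mem_Icc]
    exact abs_le.1 (hR j hj i)
  calc ∑ j ∈ T, ((1 + ((l1 j : ℕ) : ℝ)) ^ 6)⁻¹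
      ≤ ∑ j ∈ T, ∏ i, w1 (j i) := Finset.sum_le_sum fun j _ => inv_pow_six_le_prod j
    _ ≤ ∑ j ∈ box, ∏ i, w1 (j i) :=
        Finset.sum_le_sum_of_subset_of_nonneg hT fun j _ _ => Finset.prod_nonneg fun i _ => w1_nonneg _
    _ = ∏ _i : Fin 3, ∑ n ∈ Finset.Icc (-R) R, w1 n := by
        rw [hbox, Finset.prod_univ_sum]
    _ ≤ ∏ _i : Fin 3, ∑' n : ℤ, w1 n := by
        refine Finset.prod_le_prod (fun i _ => Finset.sum_nonneg fun n _ => w1_nonneg n) fun i _ => sum_w1_le _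
    _ = latC := by rw [Finset.prod_const, Finset.card_univ, Fintype.card_fin]; rfl

/-- Shifted version: `∑_{j∈T} (1+|c - j|₁)^{-6} ≤ C`. -/
theorem latticeSum_shift_le (T : Finset (Fin 3 → ℤ)) (c : Fin 3 → ℤ) :
    ∑ j ∈ T, ((1 + ((l1 (c - j) : ℕ) : ℝ)) ^ 6)⁻¹ ≤ latC := by
  classical
  have hinj : Set.InjOn (fun j => c - j) T := fun a _ b _ h => by simpa using h
  rw [← Finset.sum_image (g := fun j => c - j) (f := fun i => ((1 + ((l1 i : ℕ) : ℝ)) ^ 6)⁻¹) hinj]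
  exact latticeSum_le _

/-! ## §3 The profile, the coupling majorant, and the key weighted lattice sum -/

/-- The Gevrey-type profile `A θ^{|k|₁} (1+|k|₁)^{-6}` (verbatim as in the pieces). -/
def prof (A θ : ℝ) (k : Fin 3 → ℤ) : ℝ :=
  A * θ ^ (∑ i, (k i).natAbs) / (1 + ∑ i, ((k i).natAbs : ℝ)) ^ 6

/-- The modewise coupling majorant `ν A θ^{max(|k|₁,m)} (1+max(|k|₁,m))^{-4}` (verbatim as in the pieces). -/
def cpl (ν A θ : ℝ) (m : ℕ) (k : Fin 3 → ℤ) : ℝ :=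
  ν * A * θ ^ (max (∑ i, (k i).natAbs) m) / (1 + ((max (∑ i, (k i).natAbs) m : ℕ) : ℝ)) ^ 4

theorem prof_eq (A θ : ℝ) (k : Fin 3 → ℤ) : prof A θ k = A * θ ^ (l1 k) / (1 + ((l1 k : ℕ) : ℝ)) ^ 6 := by
  unfold prof l1; push_cast; rfl

theorem cpl_eq (ν A θ : ℝ) (m : ℕ) (k : Fin 3 → ℤ) :
    cpl ν A θ m k = ν * A * θ ^ (max (l1 k) m) / (1 + ((max (l1 k) m : ℕ) : ℝ)) ^ 4 := rfl

theorem prof_pos {A θ : ℝ} (hA : 0 < A) (hθ : 0 < θ) (k : Fin 3 → ℤ) : 0 < prof A θ k := by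
  rw [prof_eq]; positivity

theorem prof_nonneg {A θ : ℝ} (hA : 0 ≤ A) (hθ : 0 ≤ θ) (k : Fin 3 → ℤ) : 0 ≤ prof A θ k := by
  rw [prof_eq]; positivity

/-- abbreviation: `q n = (1 + n)` as a real, the polynomial weight base. -/
theorem one_add_pos (n : ℕ) : (0 : ℝ) < 1 + (n : ℝ) := by positivity

/-- **Product of two profile values against the `|l'|₁` weight** (`θ ≤ 1`):
`prof(k - l') · |l'|₁ · prof(l') ≤ A² θ^{|k|₁} (1+|k-l'|₁)^{-6} (1+|l'|₁)^{-5}`. -/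
theorem prof_mul_l1_mul_prof_le {A θ : ℝ} (_hA : 0 ≤ A) (hθ : 0 ≤ θ) (hθ1 : θ ≤ 1) (k l' : Fin 3 → ℤ) :
    prof A θ (k - l') * ((l1 l' : ℕ) : ℝ) * prof A θ l' ≤
      A ^ 2 * θ ^ (l1 k) * (((1 + ((l1 (k - l') : ℕ) : ℝ)) ^ 6)⁻¹ * ((1 + ((l1 l' : ℕ) : ℝ)) ^ 5)⁻¹) := by
  rw [prof_eq, prof_eq]
  have hpow : θ ^ (l1 (k - l')) * θ ^ (l1 l') ≤ θ ^ (l1 k) := by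
    rw [← pow_add]
    exact pow_le_pow_of_le_one hθ hθ1 (l1_le_l1_sub_add k l')
  set a : ℝ := 1 + ((l1 (k - l') : ℕ) : ℝ) with ha
  set b : ℝ := 1 + ((l1 l' : ℕ) : ℝ) with hb
  have ha0 : 0 < a := by rw [ha]; positivity
  have hb0 : 0 < b := by rw [hb]; positivity
  have hlb : ((l1 l' : ℕ) : ℝ) ≤ b := by rw [hb]; linarith
  have hθk : 0 ≤ θ ^ (l1 k) := pow_nonneg hθ _
  -- rewrite both sides as products and compare factor by factor
  have lhs_eq : A * θ ^ l1 (k - l') / a ^ 6 * ((l1 l' : ℕ) : ℝ) * (A * θ ^ l1 l' / b ^ 6) =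
      A ^ 2 * (θ ^ l1 (k - l') * θ ^ l1 l') * ((a ^ 6)⁻¹ * (((l1 l' : ℕ) : ℝ) * (b ^ 6)⁻¹)) := by
    field_simp
  rw [lhs_eq]
  have h5 : ((l1 l' : ℕ) : ℝ) * (b ^ 6)⁻¹ ≤ (b ^ 5)⁻¹ := by
    rw [← div_eq_mul_inv, div_le_iff₀ (by positivity)]
    calc ((l1 l' : ℕ) : ℝ) ≤ b := hlb
      _ = (b ^ 5)⁻¹ * b ^ 6 := by field_simp
  gcongr

/-- **The key weighted lattice sum.** For every finite `T`, centre `k` and floor `m`: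
`∑_{l'∈T, m ≤ |l'|₁} (1+|k-l'|₁)^{-6} (1+|l'|₁)^{-5} ≤ 96 C (1+max(|k|₁,m))^{-5}`
(regions `2|l'|₁ ≥ |k|₁` — use the `(1+|l'|₁)^{-5}` factor — and `2|l'|₁ < |k|₁` — there `|k-l'|₁ > |k|₁/2` and one
power of `(1+|l'|₁)` is spent against `(1+|k|₁)`). -/
theorem keySum_le (T : Finset (Fin 3 → ℤ)) (k : Fin 3 → ℤ) (m : ℕ) :
    ∑ l' ∈ T.filter (fun l' => m ≤ l1 l'),
        ((1 + ((l1 (k - l') : ℕ) : ℝ)) ^ 6)⁻¹ * ((1 + ((l1 l' : ℕ) : ℝ)) ^ 5)⁻¹ ≤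
      96 * latC * ((1 + ((max (l1 k) m : ℕ) : ℝ)) ^ 5)⁻¹ := by
  classical
  set F := T.filter (fun l' => m ≤ l1 l') with hF
  set P : ℝ := 1 + ((max (l1 k) m : ℕ) : ℝ) with hP
  have hP0 : 0 < P := by rw [hP]; positivity
  rw [← Finset.sum_filter_add_sum_filter_not F (fun l' => l1 k ≤ 2 * l1 l')]
  -- region 1
  have h1 : ∑ l' ∈ F.filter (fun l' => l1 k ≤ 2 * l1 l'),
      ((1 + ((l1 (k - l') : ℕ) : ℝ)) ^ 6)⁻¹ * ((1 + ((l1 l' : ℕ) : ℝ)) ^ 5)⁻¹ ≤ 32 * latC * (P ^ 5)⁻¹ := by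
    calc ∑ l' ∈ F.filter (fun l' => l1 k ≤ 2 * l1 l'),
          ((1 + ((l1 (k - l') : ℕ) : ℝ)) ^ 6)⁻¹ * ((1 + ((l1 l' : ℕ) : ℝ)) ^ 5)⁻¹
        ≤ ∑ l' ∈ F.filter (fun l' => l1 k ≤ 2 * l1 l'),
          ((1 + ((l1 (k - l') : ℕ) : ℝ)) ^ 6)⁻¹ * (32 * (P ^ 5)⁻¹) := by
          refine Finset.sum_le_sum fun l' hl' => ?_
          rw [Finset.mem_filter, hF, Finset.mem_filter] at hl'
          obtain ⟨⟨-, hm⟩, hk⟩ := hl'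
          refine mul_le_mul_of_nonneg_left ?_ (by positivity)
          -- 2 (1 + |l'|₁) ≥ P
          have hb : P ≤ 2 * (1 + ((l1 l' : ℕ) : ℝ)) := by
            rw [hP]
            have : (max (l1 k) m : ℝ) ≤ 2 * (l1 l' : ℕ) := by
              refine max_le ?_ ?_
              · exact_mod_cast hk
              · have : (m : ℝ) ≤ (l1 l' : ℕ) := by exact_mod_cast hm
                linarith
            push_cast at this ⊢
            linarith
          rw [show (32 : ℝ) * (P ^ 5)⁻¹ = ((P / 2) ^ 5)⁻¹ by field_simp; ring]
          exact inv_anti₀ (by positivity) (pow_le_pow_left₀ (by positivity) (by linarith) 5)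
      _ = 32 * (P ^ 5)⁻¹ * ∑ l' ∈ F.filter (fun l' => l1 k ≤ 2 * l1 l'), ((1 + ((l1 (k - l') : ℕ) : ℝ)) ^ 6)⁻¹ := by
          rw [Finset.mul_sum]; refine Finset.sum_congr rfl fun _ _ => by ring
      _ ≤ 32 * (P ^ 5)⁻¹ * latC :=
          mul_le_mul_of_nonneg_left (latticeSum_shift_le _ k) (by positivity)
      _ = 32 * latC * (P ^ 5)⁻¹ := by ring
  -- region 2
  have h2 : ∑ l' ∈ F.filter (fun l' => ¬ l1 k ≤ 2 * l1 l'),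
      ((1 + ((l1 (k - l') : ℕ) : ℝ)) ^ 6)⁻¹ * ((1 + ((l1 l' : ℕ) : ℝ)) ^ 5)⁻¹ ≤ 64 * latC * (P ^ 5)⁻¹ := by
    calc ∑ l' ∈ F.filter (fun l' => ¬ l1 k ≤ 2 * l1 l'),
          ((1 + ((l1 (k - l') : ℕ) : ℝ)) ^ 6)⁻¹ * ((1 + ((l1 l' : ℕ) : ℝ)) ^ 5)⁻¹
        ≤ ∑ l' ∈ F.filter (fun l' => ¬ l1 k ≤ 2 * l1 l'),
          (64 * (P ^ 5)⁻¹) * ((1 + ((l1 l' : ℕ) : ℝ)) ^ 6)⁻¹ := by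
          refine Finset.sum_le_sum fun l' hl' => ?_
          rw [Finset.mem_filter, hF, Finset.mem_filter] at hl'
          obtain ⟨⟨-, hm⟩, hk⟩ := hl'
          push Not at hk
          -- here ρ = |k|₁, |k - l'|₁ > |k|₁ / 2 and |l'|₁ ≤ ρ
          have hρ : max (l1 k) m = l1 k := max_eq_left (by omega)
          have hkl : l1 k ≤ l1 (k - l') + l1 l' := l1_le_l1_sub_add k l'
          have ha : P ≤ 2 * (1 + ((l1 (k - l') : ℕ) : ℝ)) := by
            rw [hP, hρ]
            have : l1 k + 1 ≤ 2 * l1 (k - l') + 2 := by omega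
            have : ((l1 k : ℕ) : ℝ) + 1 ≤ 2 * ((l1 (k - l') : ℕ) : ℝ) + 2 := by exact_mod_cast this
            linarith
          have hb : ((l1 l' : ℕ) : ℝ) + 1 ≤ P := by
            rw [hP, hρ]
            have : l1 l' + 1 ≤ 1 + l1 k := by omega
            exact_mod_cast this
          set a : ℝ := 1 + ((l1 (k - l') : ℕ) : ℝ)
          set b : ℝ := 1 + ((l1 l' : ℕ) : ℝ)
          have ha0 : 0 < a := by positivity
          have hb0 : 0 < b := by positivity
          have e1 : (a ^ 6)⁻¹ ≤ 64 * (P ^ 6)⁻¹ := by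
            rw [show (64 : ℝ) * (P ^ 6)⁻¹ = ((P / 2) ^ 6)⁻¹ by field_simp; ring]
            exact inv_anti₀ (by positivity) (pow_le_pow_left₀ (by positivity) (by linarith) 6)
          have e2 : (b ^ 5)⁻¹ ≤ P * (b ^ 6)⁻¹ := by
            rw [le_mul_inv_iff₀ (by positivity)]
            calc (b ^ 5)⁻¹ * b ^ 6 = b := by field_simp
              _ ≤ P := by linarith
          calc (a ^ 6)⁻¹ * (b ^ 5)⁻¹ ≤ (64 * (P ^ 6)⁻¹) * (P * (b ^ 6)⁻¹) := by gcongr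
            _ = 64 * (P ^ 5)⁻¹ * (b ^ 6)⁻¹ := by field_simp
      _ = 64 * (P ^ 5)⁻¹ * ∑ l' ∈ F.filter (fun l' => ¬ l1 k ≤ 2 * l1 l'), ((1 + ((l1 l' : ℕ) : ℝ)) ^ 6)⁻¹ := by
          rw [Finset.mul_sum]
      _ ≤ 64 * (P ^ 5)⁻¹ * latC := mul_le_mul_of_nonneg_left (latticeSum_le _) (by positivity)
      _ = 64 * latC * (P ^ 5)⁻¹ := by ring
  linarith

/-! ## §4 The convection symbol against the profile box -/

/-- **Norm of the convection symbol**: `‖B(c,c')_k‖ ≤ 2π ∑_{l'∈S} ‖c (k-l')‖ |l'|₁ ‖c' l'‖` (the `l`-sum collapses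
on `l = k - l'`; dropping the constraint `k - l' ∈ S` only enlarges the bound). [folklore] -/
theorem norm_convectionCoeff_le (S : Finset (Fin 3 → ℤ)) (c c' : (Fin 3 → ℤ) → EuclideanSpace ℂ (Fin 3))
    (k : Fin 3 → ℤ) :
    ‖convectionCoeff S c c' k‖ ≤ 2 * Real.pi * ∑ l' ∈ S, ‖c (k - l')‖ * ((l1 l' : ℕ) : ℝ) * ‖c' l'‖ := by
  classical
  rw [convectionCoeff_def]
  calc ‖∑ l ∈ S, ∑ m ∈ S, (if l + m = k then (2 * Real.pi * Complex.I * ∑ j, c l j * ((m j : ℤ) : ℂ)) • c' m else 0)‖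
      ≤ ∑ l ∈ S, ‖∑ m ∈ S, (if l + m = k then (2 * Real.pi * Complex.I * ∑ j, c l j * ((m j : ℤ) : ℂ)) • c' m else 0)‖ :=
        norm_sum_le _ _
    _ ≤ ∑ l ∈ S, ∑ m ∈ S, ‖(if l + m = k then (2 * Real.pi * Complex.I * ∑ j, c l j * ((m j : ℤ) : ℂ)) • c' m else 0)‖ :=
        Finset.sum_le_sum fun l _ => norm_sum_le _ _
    _ ≤ ∑ l ∈ S, ∑ m ∈ S, (if l = k - m then 2 * Real.pi * (‖c l‖ * ((l1 m : ℕ) : ℝ) * ‖c' m‖) else 0) := by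
        refine Finset.sum_le_sum fun l _ => Finset.sum_le_sum fun m _ => ?_
        by_cases h : l + m = k
        · have h' : l = k - m := by rw [← h]; abel
          rw [if_pos h, if_pos h', norm_smul]
          have hs : ‖2 * (Real.pi : ℂ) * Complex.I * ∑ j, c l j * ((m j : ℤ) : ℂ)‖ ≤ 2 * Real.pi * (‖c l‖ * ((l1 m : ℕ) : ℝ)) := by
            rw [norm_mul, norm_mul, norm_mul, Complex.norm_I, mul_one, Complex.norm_real, Real.norm_eq_abs,
              abs_of_pos Real.pi_pos, Complex.norm_ofNat]
            exact mul_le_mul_of_nonneg_left (norm_sum_mul_le (c l) m) (by positivity)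
          calc ‖2 * (Real.pi : ℂ) * Complex.I * ∑ j, c l j * ((m j : ℤ) : ℂ)‖ * ‖c' m‖
              ≤ 2 * Real.pi * (‖c l‖ * ((l1 m : ℕ) : ℝ)) * ‖c' m‖ := mul_le_mul_of_nonneg_right hs (norm_nonneg _)
            _ = 2 * Real.pi * (‖c l‖ * ((l1 m : ℕ) : ℝ) * ‖c' m‖) := by ring
        · have h' : ¬ l = k - m := fun h' => h (by rw [h']; abel)
          rw [if_neg h, if_neg h', norm_zero]
    _ = ∑ m ∈ S, ∑ l ∈ S, (if l = k - m then 2 * Real.pi * (‖c l‖ * ((l1 m : ℕ) : ℝ) * ‖c' m‖) else 0) := Finset.sum_comm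
    _ = ∑ m ∈ S, (if k - m ∈ S then 2 * Real.pi * (‖c (k - m)‖ * ((l1 m : ℕ) : ℝ) * ‖c' m‖) else 0) := by
        refine Finset.sum_congr rfl fun m _ => ?_
        rw [Finset.sum_ite_eq' S (k - m) (fun l => 2 * Real.pi * (‖c l‖ * ((l1 m : ℕ) : ℝ) * ‖c' m‖))]
    _ ≤ ∑ m ∈ S, 2 * Real.pi * (‖c (k - m)‖ * ((l1 m : ℕ) : ℝ) * ‖c' m‖) := by
        refine Finset.sum_le_sum fun m _ => ?_
        split_ifs
        · exact le_rfl
        · positivity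
    _ = 2 * Real.pi * ∑ l' ∈ S, ‖c (k - l')‖ * ((l1 l' : ℕ) : ℝ) * ‖c' l'‖ := by rw [Finset.mul_sum]

/-- **The convection symbol inside the profile box**: if `‖c j‖ ≤ prof(j)` for all `j` then
`‖B(c,c)_k‖ ≤ 192 π C · A (1+|k|₁) · prof(k)`. -/
theorem norm_convectionCoeff_le_of_box {A θ : ℝ} (hA : 0 ≤ A) (hθ : 0 ≤ θ) (hθ1 : θ ≤ 1)
    (S : Finset (Fin 3 → ℤ)) (c : (Fin 3 → ℤ) → EuclideanSpace ℂ (Fin 3)) (hc : ∀ j, ‖c j‖ ≤ prof A θ j)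
    (k : Fin 3 → ℤ) :
    ‖convectionCoeff S c c k‖ ≤ 192 * Real.pi * latC * (A * (1 + ((l1 k : ℕ) : ℝ)) * prof A θ k) := by
  classical
  have hsum : ∑ l' ∈ S, ‖c (k - l')‖ * ((l1 l' : ℕ) : ℝ) * ‖c l'‖ ≤
      A ^ 2 * θ ^ (l1 k) * (96 * latC * ((1 + ((l1 k : ℕ) : ℝ)) ^ 5)⁻¹) := by
    calc ∑ l' ∈ S, ‖c (k - l')‖ * ((l1 l' : ℕ) : ℝ) * ‖c l'‖
        ≤ ∑ l' ∈ S, prof A θ (k - l') * ((l1 l' : ℕ) : ℝ) * prof A θ l' := by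
          refine Finset.sum_le_sum fun l' _ => ?_
          have h1 := hc (k - l'); have h2 := hc l'
          have : 0 ≤ prof A θ (k - l') := prof_nonneg hA hθ _
          gcongr
      _ ≤ ∑ l' ∈ S, A ^ 2 * θ ^ (l1 k) * (((1 + ((l1 (k - l') : ℕ) : ℝ)) ^ 6)⁻¹ * ((1 + ((l1 l' : ℕ) : ℝ)) ^ 5)⁻¹) :=
          Finset.sum_le_sum fun l' _ => prof_mul_l1_mul_prof_le hA hθ hθ1 k l'
      _ = A ^ 2 * θ ^ (l1 k) * ∑ l' ∈ S.filter (fun l' => 0 ≤ l1 l'),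
            ((1 + ((l1 (k - l') : ℕ) : ℝ)) ^ 6)⁻¹ * ((1 + ((l1 l' : ℕ) : ℝ)) ^ 5)⁻¹ := by
          rw [Finset.filter_true_of_mem fun l' _ => Nat.zero_le (l1 l'), Finset.mul_sum]
      _ ≤ A ^ 2 * θ ^ (l1 k) * (96 * latC * ((1 + ((max (l1 k) 0 : ℕ) : ℝ)) ^ 5)⁻¹) :=
          mul_le_mul_of_nonneg_left (keySum_le S k 0) (by positivity)
      _ = A ^ 2 * θ ^ (l1 k) * (96 * latC * ((1 + ((l1 k : ℕ) : ℝ)) ^ 5)⁻¹) := by rw [Nat.max_eq_left (Nat.zero_le _)]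
  calc ‖convectionCoeff S c c k‖ ≤ 2 * Real.pi * ∑ l' ∈ S, ‖c (k - l')‖ * ((l1 l' : ℕ) : ℝ) * ‖c l'‖ :=
        norm_convectionCoeff_le S c c k
    _ ≤ 2 * Real.pi * (A ^ 2 * θ ^ (l1 k) * (96 * latC * ((1 + ((l1 k : ℕ) : ℝ)) ^ 5)⁻¹)) :=
        mul_le_mul_of_nonneg_left hsum (by positivity)
    _ = 192 * Real.pi * latC * (A * (1 + ((l1 k : ℕ) : ℝ)) * prof A θ k) := by
        rw [prof_eq]
        field_simp
        ring

/-! ## §5 Clause (i): per-mode tail entrance -/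

/-- Real part of `⟪x, -a • x + L⟫` for a real scalar `a`. -/
theorem re_inner_neg_smul_add (x L : EuclideanSpace ℂ (Fin 3)) (a : ℝ) :
    (inner ℂ x (-(((a : ℝ) : ℂ) • x) + L)).re = -a * ‖x‖ ^ 2 + (inner ℂ x L).re := by
  rw [inner_add_right, inner_neg_right, inner_smul_right, Complex.add_re, Complex.neg_re, Complex.mul_re,
    Complex.ofReal_re, Complex.ofReal_im, zero_mul, sub_zero]
  have h := inner_self_eq_norm_sq (𝕜 := ℂ) x
  rw [RCLike.re_to_complex] at h
  rw [h]
  ring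

/-- Box bounds extend to the zero extension. -/
theorem norm_coeffExt_le_prof {A θ : ℝ} (hA : 0 ≤ A) (hθ : 0 ≤ θ) {S : Finset (Fin 3 → ℤ)}
    (x : ↥S → EuclideanSpace ℂ (Fin 3)) (hx : ∀ l : ↥S, ‖x l‖ ≤ prof A θ l) (j : Fin 3 → ℤ) :
    ‖coeffExt S x j‖ ≤ prof A θ j := by
  by_cases hj : j ∈ S
  · rw [coeffExt_of_mem x hj]; exact hx ⟨j, hj⟩
  · rw [coeffExt_of_not_mem x hj, norm_zero]; exact prof_nonneg hA hθ j

/-- **Clause (i), quantitative form.** For a mode `k` with no force on it, sitting on its box face `‖x k‖ = prof(k)`, all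
modes inside the box: `Re⟪x k, (galerkinRHS ν g x) k⟫ ≤ prof(k)² (192 π C A (1+|k|₁) − 4π² ν |k|₂²)`. -/
theorem re_inner_field_le {ν A θ : ℝ} (hA : 0 < A) (hθ : 0 < θ) (hθ1 : θ ≤ 1) {N : ℕ}
    (x g : ↥(freqBall N : Finset (Fin 3 → ℤ)) → EuclideanSpace ℂ (Fin 3))
    (hx : ∀ l : ↥(freqBall N : Finset (Fin 3 → ℤ)), ‖x l‖ ≤ prof A θ l)
    (k : ↥(freqBall N : Finset (Fin 3 → ℤ))) (hg : g k = 0) (hnorm : ‖x k‖ = prof A θ k) :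
    (inner ℂ (x k) (galerkinRHS (freqBall N : Finset (Fin 3 → ℤ)) ν g x k)).re ≤
      prof A θ k ^ 2 * (192 * Real.pi * latC * (A * (1 + ((l1 (k : Fin 3 → ℤ) : ℕ) : ℝ))) -
        ν * (4 * Real.pi ^ 2 * freqNormSq (k : Fin 3 → ℤ))) := by
  set L : ℝ := ((l1 (k : Fin 3 → ℤ) : ℕ) : ℝ) with hL
  set Q : ℝ := freqNormSq (k : Fin 3 → ℤ) with hQ
  set p : ℝ := prof A θ k with hp
  have hp0 : 0 < p := prof_pos hA hθ _
  rw [galerkinRHS_apply, galerkinField_def, coeffExt_coe, coeffExt_coe, hg, re_inner_neg_smul_add]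
  have hconv : ‖convectionCoeff (freqBall N : Finset (Fin 3 → ℤ)) (coeffExt (freqBall N : Finset (Fin 3 → ℤ)) x)
      (coeffExt (freqBall N : Finset (Fin 3 → ℤ)) x) (k : Fin 3 → ℤ)‖ ≤ 192 * Real.pi * latC * (A * (1 + L) * p) :=
    norm_convectionCoeff_le_of_box hA.le hθ.le hθ1 _ _ (norm_coeffExt_le_prof hA.le hθ.le x hx) k
  have hLer : (inner ℂ (x k) (leraySym (k : Fin 3 → ℤ)
      (0 - convectionCoeff (freqBall N : Finset (Fin 3 → ℤ)) (coeffExt (freqBall N : Finset (Fin 3 → ℤ)) x)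
        (coeffExt (freqBall N : Finset (Fin 3 → ℤ)) x) (k : Fin 3 → ℤ)))).re ≤
      p * (192 * Real.pi * latC * (A * (1 + L) * p)) := by
    refine ((Complex.re_le_norm _).trans (norm_inner_le_norm _ _)).trans ?_
    rw [hnorm]
    refine mul_le_mul_of_nonneg_left ((norm_leraySym_le _ _).trans ?_) hp0.le
    rwa [zero_sub, norm_neg]
  rw [hnorm]
  have h5 : p * (192 * Real.pi * latC * (A * (1 + L) * p)) = p ^ 2 * (192 * Real.pi * latC * (A * (1 + L))) := by ring
  have h7 : -(ν * (4 * Real.pi ^ 2 * Q)) * p ^ 2 + p ^ 2 * (192 * Real.pi * latC * (A * (1 + L))) =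
      p ^ 2 * (192 * Real.pi * latC * (A * (1 + L)) - ν * (4 * Real.pi ^ 2 * Q)) := by ring
  linarith [hLer, h5, h7]

/-- The sweeping-scale arithmetic: `288 C A < π ν (m+1)` and `m² < |k|²` give `192 π C A (1+|k|₁) < 4 π² ν |k|₂²`. -/
theorem sweeping_ineq {ν A : ℝ} (hν : 0 < ν) (hA : 0 < A) {m : ℕ} (hth : 288 * latC * A < Real.pi * ν * ((m : ℝ) + 1))
    {k : Fin 3 → ℤ} (hk : ((m : ℕ) : ℝ) ^ 2 < freqNormSq k) :
    192 * Real.pi * latC * (A * (1 + ((l1 k : ℕ) : ℝ))) < ν * (4 * Real.pi ^ 2 * freqNormSq k) := by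
  set L : ℝ := ((l1 k : ℕ) : ℝ) with hL
  set Q : ℝ := freqNormSq k with hQ
  have hpi : 0 < Real.pi := Real.pi_pos
  have hC : 0 ≤ latC := latC_nonneg
  have hL1 : (m : ℝ) + 1 ≤ L := by
    have := succ_le_l1_of_sq_lt hk
    rw [hL]; exact_mod_cast this
  have hL0 : 1 ≤ L := le_trans (by linarith [Nat.cast_nonneg (α := ℝ) m]) hL1
  have hQ3 : L ^ 2 ≤ 3 * Q := l1_sq_le_three_mul_freqNormSq _
  have h1 : 288 * latC * A * L < Real.pi * ν * L ^ 2 := by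
    have h1a : 288 * latC * A * L < Real.pi * ν * ((m : ℝ) + 1) * L := mul_lt_mul_of_pos_right hth (by linarith)
    have h1b : Real.pi * ν * ((m : ℝ) + 1) * L ≤ Real.pi * ν * L * L :=
      mul_le_mul_of_nonneg_right (mul_le_mul_of_nonneg_left hL1 (by positivity)) (by linarith)
    nlinarith
  calc 192 * Real.pi * latC * (A * (1 + L)) ≤ 192 * Real.pi * latC * (A * (2 * L)) := by gcongr; linarith
    _ = (4 * Real.pi / 3) * (288 * latC * A * L) := by ring
    _ < (4 * Real.pi / 3) * (Real.pi * ν * L ^ 2) := by gcongr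
    _ = (4 * Real.pi ^ 2 * ν / 3) * L ^ 2 := by ring
    _ ≤ (4 * Real.pi ^ 2 * ν / 3) * (3 * Q) := by gcongr
    _ = ν * (4 * Real.pi ^ 2 * Q) := by ring

/-- **Clause (i).** Beyond the sweeping scale (`288 C A < π ν (m+1)`), a tail mode `m² < |k|²` with no force on it
sitting on its box face `‖x k‖ = prof(k)`, with all modes inside the box, is a strict ENTRANCE face:
`Re⟪x k, (galerkinRHS ν g x) k⟫ < 0`. -/
theorem entrance_clause {ν A θ : ℝ} (hν : 0 < ν) (hA : 0 < A) (hθ : 0 < θ) (hθ1 : θ ≤ 1) {N m : ℕ}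
    (hth : 288 * latC * A < Real.pi * ν * ((m : ℝ) + 1))
    (x g : ↥(freqBall N : Finset (Fin 3 → ℤ)) → EuclideanSpace ℂ (Fin 3))
    (hx : ∀ l : ↥(freqBall N : Finset (Fin 3 → ℤ)), ‖x l‖ ≤ prof A θ l)
    (k : ↥(freqBall N : Finset (Fin 3 → ℤ))) (hk : ((m : ℕ) : ℝ) ^ 2 < freqNormSq (k : Fin 3 → ℤ))
    (hg : g k = 0) (hnorm : ‖x k‖ = prof A θ k) :
    (inner ℂ (x k) (galerkinRHS (freqBall N : Finset (Fin 3 → ℤ)) ν g x k)).re < 0 := by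
  have h1 := re_inner_field_le (ν := ν) hA hθ hθ1 x g hx k hg hnorm
  have h2 := sweeping_ineq hν hA hth hk
  have hp0 : 0 < prof A θ k ^ 2 := pow_pos (prof_pos hA hθ _) 2
  have h3 : prof A θ k ^ 2 * (192 * Real.pi * latC * (A * (1 + ((l1 (k : Fin 3 → ℤ) : ℕ) : ℝ))) -
      ν * (4 * Real.pi ^ 2 * freqNormSq (k : Fin 3 → ℤ))) < 0 :=
    mul_neg_of_pos_of_neg hp0 (by linarith)
  linarith

/-! ## §6 Clauses (iii)/(iv): the tail of the box is small -/

/-- One profile value in the tail, squared: `prof(k)² ≤ A² θ^{2m} (1+|k|₁)^{-6}` when `m ≤ |k|₁`. -/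
theorem prof_sq_le_of_le {A θ : ℝ} (_hA : 0 ≤ A) (hθ : 0 ≤ θ) (hθ1 : θ ≤ 1) {m : ℕ} {k : Fin 3 → ℤ}
    (hm : m ≤ l1 k) : prof A θ k ^ 2 ≤ A ^ 2 * θ ^ (2 * m) * ((1 + ((l1 k : ℕ) : ℝ)) ^ 6)⁻¹ := by
  rw [prof_eq]
  set Lr : ℝ := 1 + ((l1 k : ℕ) : ℝ) with hLr
  have hL0 : 1 ≤ Lr := by rw [hLr]; linarith [Nat.cast_nonneg (α := ℝ) (l1 k)]
  have hpow : θ ^ (l1 k) ≤ θ ^ m := pow_le_pow_of_le_one hθ hθ1 hm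
  have e : (A * θ ^ l1 k / Lr ^ 6) ^ 2 = A ^ 2 * (θ ^ l1 k) ^ 2 * ((Lr ^ 6)⁻¹ * (Lr ^ 6)⁻¹) := by
    field_simp
  rw [e, show θ ^ (2 * m) = (θ ^ m) ^ 2 by rw [mul_comm, pow_mul]]
  have h6 : (Lr ^ 6)⁻¹ ≤ 1 := inv_le_one_of_one_le₀ (one_le_pow₀ hL0)
  have h6' : 0 ≤ (Lr ^ 6)⁻¹ := by positivity
  calc A ^ 2 * (θ ^ l1 k) ^ 2 * ((Lr ^ 6)⁻¹ * (Lr ^ 6)⁻¹) ≤ A ^ 2 * (θ ^ m) ^ 2 * ((Lr ^ 6)⁻¹ * 1) := by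
        gcongr
    _ = A ^ 2 * (θ ^ m) ^ 2 * (Lr ^ 6)⁻¹ := by ring

/-- The enstrophy weight costs two powers: `|k|₂² prof(k)² ≤ A² θ^{2m} (1+|k|₁)^{-6}` when `m ≤ |k|₁`. -/
theorem freqNormSq_mul_prof_sq_le_of_le {A θ : ℝ} (_hA : 0 ≤ A) (hθ : 0 ≤ θ) (hθ1 : θ ≤ 1) {m : ℕ}
    {k : Fin 3 → ℤ} (hm : m ≤ l1 k) :
    freqNormSq k * prof A θ k ^ 2 ≤ A ^ 2 * θ ^ (2 * m) * ((1 + ((l1 k : ℕ) : ℝ)) ^ 6)⁻¹ := by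
  rw [prof_eq]
  set Lr : ℝ := 1 + ((l1 k : ℕ) : ℝ) with hLr
  have hL0 : 1 ≤ Lr := by rw [hLr]; linarith [Nat.cast_nonneg (α := ℝ) (l1 k)]
  have hQ : freqNormSq k ≤ Lr ^ 2 := by
    refine (freqNormSq_le_l1_sq k).trans ?_
    rw [hLr]; nlinarith [Nat.cast_nonneg (α := ℝ) (l1 k)]
  have hpow : θ ^ (l1 k) ≤ θ ^ m := pow_le_pow_of_le_one hθ hθ1 hm
  have e : (A * θ ^ l1 k / Lr ^ 6) ^ 2 = A ^ 2 * (θ ^ l1 k) ^ 2 * ((Lr ^ 2)⁻¹ * ((Lr ^ 4)⁻¹ * (Lr ^ 6)⁻¹)) := by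
    field_simp
  rw [e, show θ ^ (2 * m) = (θ ^ m) ^ 2 by rw [mul_comm, pow_mul]]
  have h4 : (Lr ^ 4)⁻¹ ≤ 1 := inv_le_one_of_one_le₀ (one_le_pow₀ hL0)
  have hQ0 : 0 ≤ freqNormSq k := by rw [freqNormSq]; positivity
  calc freqNormSq k * (A ^ 2 * (θ ^ l1 k) ^ 2 * ((Lr ^ 2)⁻¹ * ((Lr ^ 4)⁻¹ * (Lr ^ 6)⁻¹)))
      = (freqNormSq k * (Lr ^ 2)⁻¹) * (A ^ 2 * (θ ^ l1 k) ^ 2 * ((Lr ^ 4)⁻¹ * (Lr ^ 6)⁻¹)) := by ring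
    _ ≤ 1 * (A ^ 2 * (θ ^ m) ^ 2 * (1 * (Lr ^ 6)⁻¹)) := by
        gcongr
        rw [mul_inv_le_iff₀ (by positivity), one_mul]; exact hQ
    _ = A ^ 2 * (θ ^ m) ^ 2 * (Lr ^ 6)⁻¹ := by ring

theorem filter_freqBall_le {m N : ℕ} (hmN : m ≤ N) :
    (freqBall N : Finset (Fin 3 → ℤ)).filter (fun k => freqNormSq k ≤ ((m : ℕ) : ℝ) ^ 2) = freqBall m := by
  ext k
  simp only [Finset.mem_filter, mem_freqBall]
  exact ⟨fun hk => hk.2, fun hk => ⟨hk.trans (by gcongr), hk⟩⟩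

/-- `∑_{|k| ≤ N} g = ∑_{|k| ≤ m} g + ∑_{|k| ≤ N} 𝟙{m² < |k|²} g` for `m ≤ N`. [folklore] -/
theorem sum_freqBall_split {m N : ℕ} (hmN : m ≤ N) (g : (Fin 3 → ℤ) → ℝ) :
    ∑ k : ↥(freqBall N : Finset (Fin 3 → ℤ)), g k =
      ∑ l : ↥(freqBall m : Finset (Fin 3 → ℤ)), g l +
        ∑ k : ↥(freqBall N : Finset (Fin 3 → ℤ)), (if ((m : ℕ) : ℝ) ^ 2 < freqNormSq (k : Fin 3 → ℤ) then g k else 0) := by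
  rw [Finset.sum_coe_sort (freqBall N) g, Finset.sum_coe_sort (freqBall m) g,
    Finset.sum_coe_sort (freqBall N) (fun k => if ((m : ℕ) : ℝ) ^ 2 < freqNormSq k then g k else 0),
    ← Finset.sum_filter, ← filter_freqBall_le hmN,
    ← Finset.sum_filter_add_sum_filter_not (freqBall N) (fun k => freqNormSq k ≤ ((m : ℕ) : ℝ) ^ 2) g]
  congr 1
  refine Finset.sum_congr ?_ fun _ _ => rfl
  ext k
  simp only [Finset.mem_filter, not_le]

/-- Tail energy term of the box. -/
theorem tail_energy_le {A θ : ℝ} (hA : 0 ≤ A) (hθ : 0 ≤ θ) (hθ1 : θ ≤ 1) {m N : ℕ}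
    (x : ↥(freqBall N : Finset (Fin 3 → ℤ)) → EuclideanSpace ℂ (Fin 3))
    (hx : ∀ l : ↥(freqBall N : Finset (Fin 3 → ℤ)), ‖x l‖ ≤ prof A θ l) :
    ∑ k : ↥(freqBall N : Finset (Fin 3 → ℤ)),
        (if ((m : ℕ) : ℝ) ^ 2 < freqNormSq (k : Fin 3 → ℤ) then ‖x k‖ ^ 2 else 0) ≤ A ^ 2 * θ ^ (2 * m) * latC := by
  classical
  have step : ∀ k : ↥(freqBall N : Finset (Fin 3 → ℤ)),
      (if ((m : ℕ) : ℝ) ^ 2 < freqNormSq (k : Fin 3 → ℤ) then ‖x k‖ ^ 2 else 0) ≤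
        A ^ 2 * θ ^ (2 * m) * ((1 + ((l1 (k : Fin 3 → ℤ) : ℕ) : ℝ)) ^ 6)⁻¹ := by
    intro k
    split_ifs with hk
    · have hm : m ≤ l1 (k : Fin 3 → ℤ) := (Nat.le_succ m).trans (succ_le_l1_of_sq_lt hk)
      exact (pow_le_pow_left₀ (norm_nonneg _) (hx k) 2).trans (prof_sq_le_of_le hA hθ hθ1 hm)
    · positivity
  refine (Finset.sum_le_sum fun k _ => step k).trans ?_
  rw [← Finset.mul_sum, Finset.sum_coe_sort (freqBall N : Finset (Fin 3 → ℤ))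
    (fun k => ((1 + ((l1 k : ℕ) : ℝ)) ^ 6)⁻¹)]
  exact mul_le_mul_of_nonneg_left (latticeSum_le _) (by positivity)

/-- Tail enstrophy term of the box. -/
theorem tail_enstrophy_le {A θ : ℝ} (hA : 0 ≤ A) (hθ : 0 ≤ θ) (hθ1 : θ ≤ 1) {m N : ℕ}
    (x : ↥(freqBall N : Finset (Fin 3 → ℤ)) → EuclideanSpace ℂ (Fin 3))
    (hx : ∀ l : ↥(freqBall N : Finset (Fin 3 → ℤ)), ‖x l‖ ≤ prof A θ l) :
    ∑ k : ↥(freqBall N : Finset (Fin 3 → ℤ)),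
        (if ((m : ℕ) : ℝ) ^ 2 < freqNormSq (k : Fin 3 → ℤ) then freqNormSq (k : Fin 3 → ℤ) * ‖x k‖ ^ 2 else 0) ≤
      A ^ 2 * θ ^ (2 * m) * latC := by
  classical
  have step : ∀ k : ↥(freqBall N : Finset (Fin 3 → ℤ)),
      (if ((m : ℕ) : ℝ) ^ 2 < freqNormSq (k : Fin 3 → ℤ) then freqNormSq (k : Fin 3 → ℤ) * ‖x k‖ ^ 2 else 0) ≤
        A ^ 2 * θ ^ (2 * m) * ((1 + ((l1 (k : Fin 3 → ℤ) : ℕ) : ℝ)) ^ 6)⁻¹ := by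
    intro k
    split_ifs with hk
    · have hm : m ≤ l1 (k : Fin 3 → ℤ) := (Nat.le_succ m).trans (succ_le_l1_of_sq_lt hk)
      have hQ0 : 0 ≤ freqNormSq (k : Fin 3 → ℤ) := by rw [freqNormSq]; positivity
      exact (mul_le_mul_of_nonneg_left (pow_le_pow_left₀ (norm_nonneg _) (hx k) 2) hQ0).trans
        (freqNormSq_mul_prof_sq_le_of_le hA hθ hθ1 hm)
    · positivity
  refine (Finset.sum_le_sum fun k _ => step k).trans ?_
  rw [← Finset.mul_sum, Finset.sum_coe_sort (freqBall N : Finset (Fin 3 → ℤ))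
    (fun k => ((1 + ((l1 k : ℕ) : ℝ)) ^ 6)⁻¹)]
  exact mul_le_mul_of_nonneg_left (latticeSum_le _) (by positivity)

/-- **Clauses (iii)/(iv), quantitative form.** Inside the box, the energy and the enstrophy of order `N` exceed those
of the restriction to order `m ≤ N` by at most `½ A² θ^{2m} C` and `4π² A² θ^{2m} C`. -/
theorem tail_sums_le {A θ : ℝ} (hA : 0 ≤ A) (hθ : 0 ≤ θ) (hθ1 : θ ≤ 1) {m N : ℕ} (hmN : m ≤ N)
    (x : ↥(freqBall N : Finset (Fin 3 → ℤ)) → EuclideanSpace ℂ (Fin 3))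
    (hx : ∀ l : ↥(freqBall N : Finset (Fin 3 → ℤ)), ‖x l‖ ≤ prof A θ l) :
    (2⁻¹ * ∑ k : ↥(freqBall N : Finset (Fin 3 → ℤ)), ‖x k‖ ^ 2 ≤
      2⁻¹ * ∑ l : ↥(freqBall m : Finset (Fin 3 → ℤ)), ‖coeffExt (freqBall N : Finset (Fin 3 → ℤ)) x (l : Fin 3 → ℤ)‖ ^ 2 +
        2⁻¹ * (A ^ 2 * θ ^ (2 * m) * latC)) ∧
    (4 * Real.pi ^ 2 * ∑ k : ↥(freqBall N : Finset (Fin 3 → ℤ)), freqNormSq (k : Fin 3 → ℤ) * ‖x k‖ ^ 2 ≤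
      4 * Real.pi ^ 2 * ∑ l : ↥(freqBall m : Finset (Fin 3 → ℤ)),
        freqNormSq (l : Fin 3 → ℤ) * ‖coeffExt (freqBall N : Finset (Fin 3 → ℤ)) x (l : Fin 3 → ℤ)‖ ^ 2 +
        4 * Real.pi ^ 2 * (A ^ 2 * θ ^ (2 * m) * latC)) := by
  have eE := sum_freqBall_split hmN (fun k => ‖coeffExt (freqBall N : Finset (Fin 3 → ℤ)) x k‖ ^ 2)
  have eZ := sum_freqBall_split hmN (fun k => freqNormSq k * ‖coeffExt (freqBall N : Finset (Fin 3 → ℤ)) x k‖ ^ 2)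
  simp only [coeffExt_coe] at eE eZ
  have tE := tail_energy_le (m := m) hA hθ hθ1 x hx
  have tZ := tail_enstrophy_le (m := m) hA hθ hθ1 x hx
  constructor
  · rw [eE, mul_add]
    linarith [mul_le_mul_of_nonneg_left tE (by norm_num : (0 : ℝ) ≤ 2⁻¹)]
  · rw [eZ, mul_add]
    linarith [mul_le_mul_of_nonneg_left tZ (by positivity : (0 : ℝ) ≤ 4 * Real.pi ^ 2)]

/-! ## §7 Clause (ii): the modewise low/tail coupling -/

/-- Enlarging the frequency set does not change the convection symbol of families vanishing off the smaller set. -/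
theorem convectionCoeff_subset_eq {S T : Finset (Fin 3 → ℤ)} (hST : S ⊆ T)
    (c c' : (Fin 3 → ℤ) → EuclideanSpace ℂ (Fin 3)) (hc : ∀ j ∉ S, c j = 0) (hc' : ∀ j ∉ S, c' j = 0)
    (k : Fin 3 → ℤ) : convectionCoeff S c c' k = convectionCoeff T c c' k := by
  classical
  rw [convectionCoeff_def, convectionCoeff_def]
  refine Finset.sum_subset hST (fun l _ hl => ?_) |>.symm.trans ?_ |>.symm
  · refine Finset.sum_eq_zero fun m _ => ?_
    simp [hc l hl]
  · refine (Finset.sum_congr rfl fun l _ => Finset.sum_subset hST fun m _ hm => ?_).symm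
    simp [hc' m hm]

/-- The `θ`-power of a pair one of whose members is beyond level `m`. -/
theorem pow_pair_le {θ : ℝ} (hθ : 0 ≤ θ) (hθ1 : θ ≤ 1) {m : ℕ} {k l' : Fin 3 → ℤ}
    (hm : m ≤ l1 (k - l') + l1 l') : θ ^ (l1 (k - l') + l1 l') ≤ θ ^ (max (l1 k) m) :=
  pow_le_pow_of_le_one hθ hθ1 (max_le (l1_le_l1_sub_add k l') hm)

/-- Term bound of type (B): the OUTSIDE member is `l'` (`m+1 ≤ |l'|₁`), carrying the `|l'|₁` weight:
`prof(k-l') |l'|₁ prof(l') ≤ A² θ^{max(|k|₁,m)} (1+|k-l'|₁)^{-6} (1+|l'|₁)^{-5}`. -/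
theorem termB_le {A θ : ℝ} (_hA : 0 ≤ A) (hθ : 0 ≤ θ) (hθ1 : θ ≤ 1) {m : ℕ} (k l' : Fin 3 → ℤ)
    (hl' : m + 1 ≤ l1 l') :
    prof A θ (k - l') * ((l1 l' : ℕ) : ℝ) * prof A θ l' ≤
      A ^ 2 * θ ^ (max (l1 k) m) * (((1 + ((l1 (k - l') : ℕ) : ℝ)) ^ 6)⁻¹ * ((1 + ((l1 l' : ℕ) : ℝ)) ^ 5)⁻¹) := by
  rw [prof_eq, prof_eq]
  have hpow : θ ^ (l1 (k - l')) * θ ^ (l1 l') ≤ θ ^ (max (l1 k) m) := by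
    rw [← pow_add]; exact pow_pair_le hθ hθ1 (by omega)
  set a : ℝ := 1 + ((l1 (k - l') : ℕ) : ℝ) with ha
  set b : ℝ := 1 + ((l1 l' : ℕ) : ℝ) with hb
  have ha0 : 0 < a := by rw [ha]; positivity
  have hb0 : 0 < b := by rw [hb]; positivity
  have hlb : ((l1 l' : ℕ) : ℝ) ≤ b := by rw [hb]; linarith
  have hθk : 0 ≤ θ ^ (max (l1 k) m) := pow_nonneg hθ _
  have lhs_eq : A * θ ^ l1 (k - l') / a ^ 6 * ((l1 l' : ℕ) : ℝ) * (A * θ ^ l1 l' / b ^ 6) =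
      A ^ 2 * (θ ^ l1 (k - l') * θ ^ l1 l') * ((a ^ 6)⁻¹ * (((l1 l' : ℕ) : ℝ) * (b ^ 6)⁻¹)) := by
    field_simp
  rw [lhs_eq]
  have h5 : ((l1 l' : ℕ) : ℝ) * (b ^ 6)⁻¹ ≤ (b ^ 5)⁻¹ := by
    rw [← div_eq_mul_inv, div_le_iff₀ (by positivity)]
    calc ((l1 l' : ℕ) : ℝ) ≤ b := hlb
      _ = (b ^ 5)⁻¹ * b ^ 6 := by field_simp
  gcongr

/-- Term bound of type (A): the OUTSIDE member is `k - l'` (`m+1 ≤ |k-l'|₁`) while `|k|₁ ≤ 2m`, so the weight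
`|l'|₁ ≤ |k|₁ + |k-l'|₁ ≤ 3(1+|k-l'|₁)` is paid by the outside member:
`prof(k-l') |l'|₁ prof(l') ≤ 3 A² θ^{max(|k|₁,m)} (1+|k-l'|₁)^{-5} (1+|l'|₁)^{-6}`. -/
theorem termA_le {A θ : ℝ} (_hA : 0 ≤ A) (hθ : 0 ≤ θ) (hθ1 : θ ≤ 1) {m : ℕ} (k l' : Fin 3 → ℤ)
    (hk : l1 k ≤ 2 * m) (hl : m + 1 ≤ l1 (k - l')) :
    prof A θ (k - l') * ((l1 l' : ℕ) : ℝ) * prof A θ l' ≤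
      3 * (A ^ 2 * θ ^ (max (l1 k) m) * (((1 + ((l1 (k - l') : ℕ) : ℝ)) ^ 5)⁻¹ * ((1 + ((l1 l' : ℕ) : ℝ)) ^ 6)⁻¹)) := by
  rw [prof_eq, prof_eq]
  have hpow : θ ^ (l1 (k - l')) * θ ^ (l1 l') ≤ θ ^ (max (l1 k) m) := by
    rw [← pow_add]; exact pow_pair_le hθ hθ1 (by omega)
  have hw : l1 l' ≤ 3 * (1 + l1 (k - l')) := by
    have h1 : l1 l' ≤ l1 (l' - k) + l1 k := l1_le_l1_sub_add l' k
    have h2 : l1 (l' - k) = l1 (k - l') := by rw [← l1_neg, neg_sub]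
    omega
  set a : ℝ := 1 + ((l1 (k - l') : ℕ) : ℝ) with ha
  set b : ℝ := 1 + ((l1 l' : ℕ) : ℝ) with hb
  have ha0 : 0 < a := by rw [ha]; positivity
  have hb0 : 0 < b := by rw [hb]; positivity
  have hla : ((l1 l' : ℕ) : ℝ) ≤ 3 * a := by
    rw [ha]; exact_mod_cast hw
  have hθk : 0 ≤ θ ^ (max (l1 k) m) := pow_nonneg hθ _
  have lhs_eq : A * θ ^ l1 (k - l') / a ^ 6 * ((l1 l' : ℕ) : ℝ) * (A * θ ^ l1 l' / b ^ 6) =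
      A ^ 2 * (θ ^ l1 (k - l') * θ ^ l1 l') * ((((l1 l' : ℕ) : ℝ) * (a ^ 6)⁻¹) * (b ^ 6)⁻¹) := by
    field_simp
  have rhs_eq : 3 * (A ^ 2 * θ ^ (max (l1 k) m) * ((a ^ 5)⁻¹ * (b ^ 6)⁻¹)) =
      A ^ 2 * θ ^ (max (l1 k) m) * ((3 * (a ^ 5)⁻¹) * (b ^ 6)⁻¹) := by ring
  rw [lhs_eq, rhs_eq]
  have h5 : ((l1 l' : ℕ) : ℝ) * (a ^ 6)⁻¹ ≤ 3 * (a ^ 5)⁻¹ := by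
    rw [← div_eq_mul_inv, div_le_iff₀ (by positivity)]
    calc ((l1 l' : ℕ) : ℝ) ≤ 3 * a := hla
      _ = 3 * (a ^ 5)⁻¹ * a ^ 6 := by field_simp
  gcongr

/-- **Clause (ii).** For `m ≤ N`, `x` of order `N` inside the box, `k` of order `m`, and the sweeping condition
`768 π C A ≤ ν (m + 1)`: the `k`-th component of the order-`N` field differs from that of the order-`m` field of the
restriction by at most the coupling majorant `ν A θ^{max(|k|₁,m)} (1+max(|k|₁,m))^{-4}`. -/
theorem coupling_clause {ν A θ : ℝ} (hν : 0 < ν) (hA : 0 < A) (hθ : 0 < θ) (hθ1 : θ ≤ 1) {m N : ℕ}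
    (hmN : m ≤ N) (hth : 768 * Real.pi * latC * A ≤ ν * ((m : ℝ) + 1))
    (x : ↥(freqBall N : Finset (Fin 3 → ℤ)) → EuclideanSpace ℂ (Fin 3))
    (hx : ∀ l : ↥(freqBall N : Finset (Fin 3 → ℤ)), ‖x l‖ ≤ prof A θ l)
    (f : UnitAddTorus (Fin 3) → EuclideanSpace ℝ (Fin 3)) (k : ↥(freqBall m : Finset (Fin 3 → ℤ))) :
    ‖coeffExt (freqBall N : Finset (Fin 3 → ℤ)) (galerkinRHS (freqBall N : Finset (Fin 3 → ℤ)) ν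
          (fourierRestrict (freqBall N : Finset (Fin 3 → ℤ)) f) x) (k : Fin 3 → ℤ) -
        galerkinRHS (freqBall m : Finset (Fin 3 → ℤ)) ν (fourierRestrict (freqBall m : Finset (Fin 3 → ℤ)) f)
          (fun l : ↥(freqBall m : Finset (Fin 3 → ℤ)) => coeffExt (freqBall N : Finset (Fin 3 → ℤ)) x (l : Fin 3 → ℤ)) k‖ ≤
      cpl ν A θ m k := by
  classical
  have hsub : (freqBall m : Finset (Fin 3 → ℤ)) ⊆ freqBall N := freqBall_mono hmN
  have hkN : (k : Fin 3 → ℤ) ∈ (freqBall N : Finset (Fin 3 → ℤ)) := hsub k.2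
  -- Step 1: the difference is the Leray symbol of the difference of the convection symbols
  have hdiff0 : coeffExt (freqBall N : Finset (Fin 3 → ℤ)) (galerkinRHS (freqBall N : Finset (Fin 3 → ℤ)) ν
        (fourierRestrict (freqBall N : Finset (Fin 3 → ℤ)) f) x) (k : Fin 3 → ℤ) -
      galerkinRHS (freqBall m : Finset (Fin 3 → ℤ)) ν (fourierRestrict (freqBall m : Finset (Fin 3 → ℤ)) f)
        (fun l : ↥(freqBall m : Finset (Fin 3 → ℤ)) => coeffExt (freqBall N : Finset (Fin 3 → ℤ)) x (l : Fin 3 → ℤ)) k =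
      leraySym (k : Fin 3 → ℤ)
        (convectionCoeff (freqBall m : Finset (Fin 3 → ℤ))
            (coeffExt (freqBall m : Finset (Fin 3 → ℤ))
              (fun l : ↥(freqBall m : Finset (Fin 3 → ℤ)) => coeffExt (freqBall N : Finset (Fin 3 → ℤ)) x (l : Fin 3 → ℤ)))
            (coeffExt (freqBall m : Finset (Fin 3 → ℤ))
              (fun l : ↥(freqBall m : Finset (Fin 3 → ℤ)) => coeffExt (freqBall N : Finset (Fin 3 → ℤ)) x (l : Fin 3 → ℤ)))
            (k : Fin 3 → ℤ) -
          convectionCoeff (freqBall N : Finset (Fin 3 → ℤ)) (coeffExt (freqBall N : Finset (Fin 3 → ℤ)) x)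
            (coeffExt (freqBall N : Finset (Fin 3 → ℤ)) x) (k : Fin 3 → ℤ)) := by
    rw [coeffExt_of_mem _ hkN, galerkinRHS_apply, galerkinRHS_apply, galerkinField_def, galerkinField_def]
    simp only [coeffExt_coe, fourierRestrict_apply, coeffExt_of_mem _ hkN, leraySym_sub]
    abel
  rw [hdiff0]
  -- notation: the full family `xb`, its cut-off `yb` at level `m`, and the shell part `z`
  set xb : (Fin 3 → ℤ) → EuclideanSpace ℂ (Fin 3) := coeffExt (freqBall N : Finset (Fin 3 → ℤ)) x with hxb
  set yb : (Fin 3 → ℤ) → EuclideanSpace ℂ (Fin 3) := coeffExt (freqBall m : Finset (Fin 3 → ℤ))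
    (fun l : ↥(freqBall m : Finset (Fin 3 → ℤ)) => xb (l : Fin 3 → ℤ)) with hyb
  set z : (Fin 3 → ℤ) → EuclideanSpace ℂ (Fin 3) := xb - yb with hz
  -- values of yb and z
  have hyb_mem : ∀ j ∈ (freqBall m : Finset (Fin 3 → ℤ)), yb j = xb j := fun j hj => by
    rw [hyb, coeffExt_of_mem _ hj]
  have hyb_nmem : ∀ j ∉ (freqBall m : Finset (Fin 3 → ℤ)), yb j = 0 := fun j hj => by
    rw [hyb, coeffExt_of_not_mem _ hj]
  have hz_mem : ∀ j ∈ (freqBall m : Finset (Fin 3 → ℤ)), z j = 0 := fun j hj => by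
    rw [hz, Pi.sub_apply, hyb_mem j hj, sub_self]
  have hz_nmem : ∀ j ∉ (freqBall m : Finset (Fin 3 → ℤ)), z j = xb j := fun j hj => by
    rw [hz, Pi.sub_apply, hyb_nmem j hj, sub_zero]
  have hxb_le : ∀ j, ‖xb j‖ ≤ prof A θ j := norm_coeffExt_le_prof hA.le hθ.le x hx
  have hyb_le : ∀ j, ‖yb j‖ ≤ prof A θ j := fun j => by
    by_cases hj : j ∈ (freqBall m : Finset (Fin 3 → ℤ))
    · rw [hyb_mem j hj]; exact hxb_le j
    · rw [hyb_nmem j hj, norm_zero]; exact prof_nonneg hA.le hθ.le j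
  have hz_le : ∀ j, ‖z j‖ ≤ prof A θ j := fun j => by
    by_cases hj : j ∈ (freqBall m : Finset (Fin 3 → ℤ))
    · rw [hz_mem j hj, norm_zero]; exact prof_nonneg hA.le hθ.le j
    · rw [hz_nmem j hj]; exact hxb_le j
  -- tail membership gives the `m+1 ≤ |·|₁` floor
  have hfloor : ∀ j ∉ (freqBall m : Finset (Fin 3 → ℤ)), m + 1 ≤ l1 j := fun j hj =>
    succ_le_l1_of_sq_lt (not_mem_freqBall.1 hj)
  have hk2m : l1 (k : Fin 3 → ℤ) ≤ 2 * m := l1_le_two_mul_of_sq_le (mem_freqBall.1 k.2)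
  -- the cut-off family's convection symbol can be computed on the larger set
  rw [convectionCoeff_subset_eq hsub yb yb hyb_nmem hyb_nmem]
  refine (norm_leraySym_le _ _).trans ?_
  -- Step 2: bilinear splitting  B(xb,xb) - B(yb,yb) = B(z, xb) + B(yb, z)
  have hsplit : convectionCoeff (freqBall N : Finset (Fin 3 → ℤ)) xb xb (k : Fin 3 → ℤ) -
      convectionCoeff (freqBall N : Finset (Fin 3 → ℤ)) yb yb (k : Fin 3 → ℤ) =
      convectionCoeff (freqBall N : Finset (Fin 3 → ℤ)) z xb (k : Fin 3 → ℤ) +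
        convectionCoeff (freqBall N : Finset (Fin 3 → ℤ)) yb z (k : Fin 3 → ℤ) := by
    have exb : xb = yb + z := by rw [hz]; abel
    conv_lhs => rw [exb]
    rw [convectionCoeff_add_left, convectionCoeff_add_right, convectionCoeff_add_right]
    have : convectionCoeff (freqBall N : Finset (Fin 3 → ℤ)) z (yb + z) (k : Fin 3 → ℤ) =
        convectionCoeff (freqBall N : Finset (Fin 3 → ℤ)) z xb (k : Fin 3 → ℤ) := by rw [← exb]
    rw [convectionCoeff_add_right] at this
    rw [← this]
    abel
  rw [norm_sub_rev, hsplit]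
  refine (norm_add_le _ _).trans ?_
  -- Step 3: the two sums
  set ρ : ℕ := max (l1 (k : Fin 3 → ℤ)) m with hρ
  set P : ℝ := 1 + ((ρ : ℕ) : ℝ) with hP
  have hP0 : 0 < P := by rw [hP]; positivity
  have hC : 0 ≤ latC := latC_nonneg
  have hθρ : 0 ≤ θ ^ ρ := pow_nonneg hθ.le _
  -- (A): outside member k - l'
  have hA_sum : ∑ l' ∈ (freqBall N : Finset (Fin 3 → ℤ)), ‖z ((k : Fin 3 → ℤ) - l')‖ * ((l1 l' : ℕ) : ℝ) * ‖xb l'‖ ≤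
      3 * (A ^ 2 * θ ^ ρ) * (96 * latC * (P ^ 5)⁻¹) := by
    -- termwise against an indicator of the floor on k - l'
    have step : ∀ l' ∈ (freqBall N : Finset (Fin 3 → ℤ)),
        ‖z ((k : Fin 3 → ℤ) - l')‖ * ((l1 l' : ℕ) : ℝ) * ‖xb l'‖ ≤
          (if m + 1 ≤ l1 ((k : Fin 3 → ℤ) - l') then
            3 * (A ^ 2 * θ ^ ρ) * (((1 + ((l1 ((k : Fin 3 → ℤ) - l') : ℕ) : ℝ)) ^ 5)⁻¹ *
              ((1 + ((l1 l' : ℕ) : ℝ)) ^ 6)⁻¹) else 0) := by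
      intro l' _
      by_cases hj : ((k : Fin 3 → ℤ) - l') ∈ (freqBall m : Finset (Fin 3 → ℤ))
      · rw [hz_mem _ hj, norm_zero, zero_mul, zero_mul]
        split_ifs <;> positivity
      · rw [if_pos (hfloor _ hj)]
        calc ‖z ((k : Fin 3 → ℤ) - l')‖ * ((l1 l' : ℕ) : ℝ) * ‖xb l'‖
            ≤ prof A θ ((k : Fin 3 → ℤ) - l') * ((l1 l' : ℕ) : ℝ) * prof A θ l' := by
              have := hz_le ((k : Fin 3 → ℤ) - l'); have := hxb_le l'
              have : 0 ≤ prof A θ ((k : Fin 3 → ℤ) - l') := prof_nonneg hA.le hθ.le _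
              gcongr
          _ ≤ _ := by
              have := termA_le hA.le hθ.le hθ1 (k : Fin 3 → ℤ) l' hk2m (hfloor _ hj)
              simpa only [mul_assoc] using this
    refine (Finset.sum_le_sum step).trans ?_
    rw [← Finset.sum_filter]
    -- reindex l'' = k - l'
    have hinj : Set.InjOn (fun l' => (k : Fin 3 → ℤ) - l') ((freqBall N : Finset (Fin 3 → ℤ)).filter
        (fun l' => m + 1 ≤ l1 ((k : Fin 3 → ℤ) - l'))) := fun a _ b _ h => by simpa using h
    have himg : ((freqBall N : Finset (Fin 3 → ℤ)).filter (fun l' => m + 1 ≤ l1 ((k : Fin 3 → ℤ) - l'))).image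
        (fun l' => (k : Fin 3 → ℤ) - l') =
        (((freqBall N : Finset (Fin 3 → ℤ)).image (fun l' => (k : Fin 3 → ℤ) - l')).filter (fun j => m + 1 ≤ l1 j)) := by
      rw [Finset.filter_image]
    calc ∑ l' ∈ (freqBall N : Finset (Fin 3 → ℤ)).filter (fun l' => m + 1 ≤ l1 ((k : Fin 3 → ℤ) - l')),
          3 * (A ^ 2 * θ ^ ρ) * (((1 + ((l1 ((k : Fin 3 → ℤ) - l') : ℕ) : ℝ)) ^ 5)⁻¹ * ((1 + ((l1 l' : ℕ) : ℝ)) ^ 6)⁻¹)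
        = ∑ j ∈ (((freqBall N : Finset (Fin 3 → ℤ)).image (fun l' => (k : Fin 3 → ℤ) - l')).filter (fun j => m + 1 ≤ l1 j)),
          3 * (A ^ 2 * θ ^ ρ) * (((1 + ((l1 ((k : Fin 3 → ℤ) - j) : ℕ) : ℝ)) ^ 6)⁻¹ * ((1 + ((l1 j : ℕ) : ℝ)) ^ 5)⁻¹) := by
          rw [← himg, Finset.sum_image hinj]
          refine Finset.sum_congr rfl fun l' _ => ?_
          rw [sub_sub_cancel, mul_comm (((1 + ((l1 ((k : Fin 3 → ℤ) - l') : ℕ) : ℝ)) ^ 5)⁻¹)]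
      _ = 3 * (A ^ 2 * θ ^ ρ) * ∑ j ∈ (((freqBall N : Finset (Fin 3 → ℤ)).image (fun l' => (k : Fin 3 → ℤ) - l')).filter
            (fun j => m + 1 ≤ l1 j)),
          ((1 + ((l1 ((k : Fin 3 → ℤ) - j) : ℕ) : ℝ)) ^ 6)⁻¹ * ((1 + ((l1 j : ℕ) : ℝ)) ^ 5)⁻¹ := by rw [Finset.mul_sum]
      _ ≤ 3 * (A ^ 2 * θ ^ ρ) * (96 * latC * ((1 + ((max (l1 (k : Fin 3 → ℤ)) (m + 1) : ℕ) : ℝ)) ^ 5)⁻¹) :=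
          mul_le_mul_of_nonneg_left (keySum_le _ _ (m + 1)) (by positivity)
      _ ≤ 3 * (A ^ 2 * θ ^ ρ) * (96 * latC * (P ^ 5)⁻¹) := by
          gcongr
          rw [hP, hρ]
          have hmm : max (l1 (k : Fin 3 → ℤ)) m ≤ max (l1 (k : Fin 3 → ℤ)) (m + 1) := max_le_max le_rfl (Nat.le_succ m)
          have hmm' : ((max (l1 (k : Fin 3 → ℤ)) m : ℕ) : ℝ) ≤ ((max (l1 (k : Fin 3 → ℤ)) (m + 1) : ℕ) : ℝ) := by
            exact_mod_cast hmm
          linarith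
  -- (B): outside member l'
  have hB_sum : ∑ l' ∈ (freqBall N : Finset (Fin 3 → ℤ)), ‖yb ((k : Fin 3 → ℤ) - l')‖ * ((l1 l' : ℕ) : ℝ) * ‖z l'‖ ≤
      (A ^ 2 * θ ^ ρ) * (96 * latC * (P ^ 5)⁻¹) := by
    have step : ∀ l' ∈ (freqBall N : Finset (Fin 3 → ℤ)),
        ‖yb ((k : Fin 3 → ℤ) - l')‖ * ((l1 l' : ℕ) : ℝ) * ‖z l'‖ ≤
          (if m + 1 ≤ l1 l' then
            (A ^ 2 * θ ^ ρ) * (((1 + ((l1 ((k : Fin 3 → ℤ) - l') : ℕ) : ℝ)) ^ 6)⁻¹ * ((1 + ((l1 l' : ℕ) : ℝ)) ^ 5)⁻¹)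
          else 0) := by
      intro l' _
      by_cases hj : l' ∈ (freqBall m : Finset (Fin 3 → ℤ))
      · rw [hz_mem _ hj, norm_zero, mul_zero]
        split_ifs <;> positivity
      · rw [if_pos (hfloor _ hj)]
        calc ‖yb ((k : Fin 3 → ℤ) - l')‖ * ((l1 l' : ℕ) : ℝ) * ‖z l'‖
            ≤ prof A θ ((k : Fin 3 → ℤ) - l') * ((l1 l' : ℕ) : ℝ) * prof A θ l' := by
              have := hyb_le ((k : Fin 3 → ℤ) - l'); have := hz_le l'
              have : 0 ≤ prof A θ ((k : Fin 3 → ℤ) - l') := prof_nonneg hA.le hθ.le _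
              gcongr
          _ ≤ _ := termB_le hA.le hθ.le hθ1 (k : Fin 3 → ℤ) l' (hfloor _ hj)
    refine (Finset.sum_le_sum step).trans ?_
    rw [← Finset.sum_filter, ← Finset.mul_sum]
    refine (mul_le_mul_of_nonneg_left (keySum_le _ _ (m + 1)) (by positivity)).trans ?_
    gcongr
    rw [hP, hρ]
    have hmm : max (l1 (k : Fin 3 → ℤ)) m ≤ max (l1 (k : Fin 3 → ℤ)) (m + 1) := max_le_max le_rfl (Nat.le_succ m)
    have hmm' : ((max (l1 (k : Fin 3 → ℤ)) m : ℕ) : ℝ) ≤ ((max (l1 (k : Fin 3 → ℤ)) (m + 1) : ℕ) : ℝ) := by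
      exact_mod_cast hmm
    linarith
  -- Step 4: combine with the convection-norm lemma and the threshold
  have hnA := norm_convectionCoeff_le (freqBall N : Finset (Fin 3 → ℤ)) z xb (k : Fin 3 → ℤ)
  have hnB := norm_convectionCoeff_le (freqBall N : Finset (Fin 3 → ℤ)) yb z (k : Fin 3 → ℤ)
  have hpi : 0 < Real.pi := Real.pi_pos
  have htot : ‖convectionCoeff (freqBall N : Finset (Fin 3 → ℤ)) z xb (k : Fin 3 → ℤ)‖ +
      ‖convectionCoeff (freqBall N : Finset (Fin 3 → ℤ)) yb z (k : Fin 3 → ℤ)‖ ≤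
      768 * Real.pi * latC * (A ^ 2 * θ ^ ρ * (P ^ 5)⁻¹) := by
    have h1 := mul_le_mul_of_nonneg_left hA_sum (by positivity : (0 : ℝ) ≤ 2 * Real.pi)
    have h2 := mul_le_mul_of_nonneg_left hB_sum (by positivity : (0 : ℝ) ≤ 2 * Real.pi)
    have e : 2 * Real.pi * (3 * (A ^ 2 * θ ^ ρ) * (96 * latC * (P ^ 5)⁻¹)) +
        2 * Real.pi * ((A ^ 2 * θ ^ ρ) * (96 * latC * (P ^ 5)⁻¹)) = 768 * Real.pi * latC * (A ^ 2 * θ ^ ρ * (P ^ 5)⁻¹) := by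
      ring
    linarith
  refine htot.trans ?_
  -- 768 π C A² θ^ρ P^{-5} ≤ ν A θ^ρ P^{-4}  ⟸  768 π C A ≤ ν P
  rw [cpl_eq, ← hρ, ← hP]
  have hPm : (m : ℝ) + 1 ≤ P := by
    rw [hP, hρ]
    have : (m : ℝ) ≤ ((max (l1 (k : Fin 3 → ℤ)) m : ℕ) : ℝ) := by exact_mod_cast le_max_right _ _
    linarith
  have hth' : 768 * Real.pi * latC * A ≤ ν * P := hth.trans (mul_le_mul_of_nonneg_left hPm hν.le)
  rw [div_eq_mul_inv]
  have e4 : (P ^ 4)⁻¹ = P * (P ^ 5)⁻¹ := by field_simp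
  rw [e4]
  calc 768 * Real.pi * latC * (A ^ 2 * θ ^ ρ * (P ^ 5)⁻¹)
      = (768 * Real.pi * latC * A) * (A * θ ^ ρ * (P ^ 5)⁻¹) := by ring
    _ ≤ (ν * P) * (A * θ ^ ρ * (P ^ 5)⁻¹) := mul_le_mul_of_nonneg_right hth' (by positivity)
    _ = ν * A * θ ^ ρ * (P * (P ^ 5)⁻¹) := by ring


/-! # PART B — a numerical bound for the lattice constant: `C ≤ 13` -/

/-- `∑_{n∈ℤ} (1+|n|)^{-2} = π²/3 − 1 ≤ 2.31`. -/
theorem tsum_w1_le : ∑' n : ℤ, w1 n ≤ 2.31 := by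
  have hz := hasSum_zeta_two
  -- positive part: n ↦ 1/(n+1)²
  have h1 : HasSum (fun n : ℕ => w1 (n : ℤ)) (Real.pi ^ 2 / 6) := by
    have := (hasSum_nat_add_iff' 1).mpr hz
    simp only [Finset.range_one, Finset.sum_singleton, Nat.cast_zero, ne_eq, OfNat.ofNat_ne_zero,
      not_false_eq_true, zero_pow, div_zero, sub_zero] at this
    refine this.congr_fun ?_ 
    intro n
    unfold w1
    rw [Int.cast_natCast, abs_of_nonneg (Nat.cast_nonneg n), one_div]
    push_cast
    ring
  -- negative part: n ↦ 1/(n+2)²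
  have h2 : HasSum (fun n : ℕ => w1 (-(n + 1 : ℕ) : ℤ)) (Real.pi ^ 2 / 6 - 1) := by
    have := (hasSum_nat_add_iff' 2).mpr hz
    simp only [Finset.sum_range_succ, Finset.range_one, Finset.sum_singleton, Nat.cast_zero, ne_eq,
      OfNat.ofNat_ne_zero, not_false_eq_true, zero_pow, div_zero, zero_add, Nat.cast_one, one_pow, div_one] at this
    refine this.congr_fun ?_
    intro n
    unfold w1
    rw [Int.cast_neg, abs_neg, Int.cast_natCast, abs_of_nonneg (Nat.cast_nonneg _), one_div]
    push_cast
    ring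
  have hsum : HasSum w1 (Real.pi ^ 2 / 6 + (Real.pi ^ 2 / 6 - 1)) := HasSum.of_nat_of_neg_add_one h1 (by
    convert h2 using 2 with n; push_cast; ring_nf)
  rw [hsum.tsum_eq]
  have hpi : Real.pi < 3.15 := Real.pi_lt_d2
  have hpi0 : 0 < Real.pi := Real.pi_pos
  nlinarith

/-- **`C = latC ≤ 13`.** -/
theorem latC_le : latC ≤ 13 := by
  unfold latC
  have h0 : 0 ≤ ∑' n : ℤ, w1 n := tsum_nonneg w1_nonneg
  have h1 := tsum_w1_le
  nlinarith [mul_nonneg h0 h0, mul_nonneg (mul_nonneg h0 h0) h0]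

/-! # PART C — generic lemmas and level maps (copy of `Lines/TailLiftSplit.lean` PART II §0–§2) -/

/-- Coefficient vectors of order `n` (the ambient real normed space of the phase space). -/
abbrev Coef (n : ℕ) : Type := ↥(freqBall n : Finset (Fin 3 → ℤ)) → EuclideanSpace ℂ (Fin 3)

/-- The Galerkin phase space of order `n` (real divergence-free coefficient vectors). -/
abbrev Phase (n : ℕ) : Type := ↥(galerkinSubspace (freqBall n : Finset (Fin 3 → ℤ)))

/-! ## §1 Two elementary lemmas -/

/-- **Sign constancy of an affine function without zeros on `[0,1]`.** [folklore] -/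
theorem neg_iff_neg_of_forall_add_mul_ne_zero {a b : ℝ} (h : ∀ s ∈ Set.Icc (0 : ℝ) 1, a + s * b ≠ 0) :
    (a + b < 0 ↔ a < 0) := by
  have ha : a ≠ 0 := by simpa using h 0 ⟨le_rfl, zero_le_one⟩
  have hab : a + b ≠ 0 := by simpa using h 1 ⟨zero_le_one, le_rfl⟩
  constructor
  · intro hlt
    by_contra hge
    have ha' : 0 < a := lt_of_le_of_ne (not_lt.1 hge) (Ne.symm ha)
    have hb : 0 < -b := by linarith
    have hs0 : 0 ≤ a / (-b) := div_nonneg ha'.le hb.le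
    have hs1 : a / (-b) ≤ 1 := by rw [div_le_one hb]; linarith
    refine h (a / (-b)) ⟨hs0, hs1⟩ ?_
    have hb0 : b ≠ 0 := by linarith
    field_simp
    ring
  · intro hlt
    by_contra hge
    have hab' : 0 < a + b := lt_of_le_of_ne (not_lt.1 hge) (Ne.symm hab)
    have hb : 0 < b := by linarith
    have hs0 : 0 ≤ (-a) / b := div_nonneg (by linarith) hb.le
    have hs1 : (-a) / b ≤ 1 := by rw [div_le_one hb]; linarith
    refine h ((-a) / b) ⟨hs0, hs1⟩ ?_
    have hb0 : b ≠ 0 := by linarith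
    field_simp
    ring

/-- **Retractions descend along a section.** If `ι : Y → X` has the continuous left inverse `P`, maps
`B` into `B'` and `E` into `E'`, and `P` maps `E'` into `E`, then a retraction of `B'` onto `E'` yields a
retraction `P ∘ r ∘ ι` of `B` onto `E`; contrapositive form. [folklore] -/
theorem not_retract_of_section {X Y : Type*} [TopologicalSpace X] [TopologicalSpace Y]
    {B E : Set Y} {B' E' : Set X} (ι : Y → X) (P : X → Y) (hι : Continuous ι) (hP : Continuous P)
    (hPι : ∀ y, P (ι y) = y) (hιB : MapsTo ι B B') (hιE : MapsTo ι E E') (hPE : MapsTo P E' E)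
    (h : ¬ ∃ r : Y → Y, ContinuousOn r B ∧ MapsTo r B E ∧ ∀ y ∈ E, r y = y) :
    ¬ ∃ r : X → X, ContinuousOn r B' ∧ MapsTo r B' E' ∧ ∀ x ∈ E', r x = x := by
  rintro ⟨r, hr, hrm, hfix⟩
  refine h ⟨fun y => P (r (ι y)), ?_, fun y hy => hPE (hrm (hιB hy)), fun y hy => ?_⟩
  · exact hP.comp_continuousOn (hr.comp hι.continuousOn hιB)
  · simp only
    rw [hfix _ (hιE hy), hPι]

/-! ## §2 Relabelling coefficient vectors between levels -/

/-- Relabel a coefficient vector on `S` as one on `T` (restriction on `S ∩ T`, zero on `T \ S`): the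
restriction `P` when `T ⊆ S` and the extension by zero `ι` when `S ⊆ T`. -/
def relabel (S T : Finset (Fin 3 → ℤ)) (v : ↥S → EuclideanSpace ℂ (Fin 3)) : ↥T → EuclideanSpace ℂ (Fin 3) :=
  fun k => coeffExt S v (k : Fin 3 → ℤ)

theorem relabel_apply (S T : Finset (Fin 3 → ℤ)) (v : ↥S → EuclideanSpace ℂ (Fin 3)) (k : ↥T) :
    relabel S T v k = coeffExt S v (k : Fin 3 → ℤ) := rfl

theorem relabel_apply_of_mem {S T : Finset (Fin 3 → ℤ)} (v : ↥S → EuclideanSpace ℂ (Fin 3)) {k : ↥T}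
    (hk : (k : Fin 3 → ℤ) ∈ S) : relabel S T v k = v ⟨k, hk⟩ :=
  coeffExt_of_mem v hk

theorem relabel_apply_of_not_mem {S T : Finset (Fin 3 → ℤ)} (v : ↥S → EuclideanSpace ℂ (Fin 3)) {k : ↥T}
    (hk : (k : Fin 3 → ℤ) ∉ S) : relabel S T v k = 0 :=
  coeffExt_of_not_mem v hk

/-- Round trip: extend from `S` to `T ⊇ S`, then restrict back. -/
theorem relabel_relabel_of_subset {S T : Finset (Fin 3 → ℤ)} (hST : S ⊆ T) (v : ↥S → EuclideanSpace ℂ (Fin 3)) :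
    relabel T S (relabel S T v) = v := by
  funext k
  rw [relabel_apply_of_mem _ (hST k.2),
    relabel_apply_of_mem (k := (⟨(k : Fin 3 → ℤ), hST k.2⟩ : ↥T)) v k.2]

/-- `coeffExt` of a relabelled vector agrees with the original `coeffExt` on `T`. -/
theorem coeffExt_relabel_of_mem {S T : Finset (Fin 3 → ℤ)} (v : ↥S → EuclideanSpace ℂ (Fin 3)) {k : Fin 3 → ℤ}
    (hk : k ∈ T) : coeffExt T (relabel S T v) k = coeffExt S v k := by
  rw [coeffExt_of_mem _ hk]; rfl

/-- Relabelling as a real linear map. -/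
def relabelₗ (S T : Finset (Fin 3 → ℤ)) : (↥S → EuclideanSpace ℂ (Fin 3)) →ₗ[ℝ] (↥T → EuclideanSpace ℂ (Fin 3)) where
  toFun := relabel S T
  map_add' v w := by funext k; simp [relabel, coeffExt_add]
  map_smul' a v := by funext k; simp [relabel, coeffExt_smul]

/-- Relabelling as a continuous real linear map (finite dimensions). -/
def relabelL (S T : Finset (Fin 3 → ℤ)) : (↥S → EuclideanSpace ℂ (Fin 3)) →L[ℝ] (↥T → EuclideanSpace ℂ (Fin 3)) :=
  LinearMap.toContinuousLinearMap (relabelₗ S T)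

@[simp] theorem relabelL_apply (S T : Finset (Fin 3 → ℤ)) (v : ↥S → EuclideanSpace ℂ (Fin 3)) :
    relabelL S T v = relabel S T v := rfl

theorem continuous_relabel (S T : Finset (Fin 3 → ℤ)) : Continuous (relabel S T) :=
  (relabelL S T).continuous

theorem hasFDerivAt_relabel (S T : Finset (Fin 3 → ℤ)) (v : ↥S → EuclideanSpace ℂ (Fin 3)) :
    HasFDerivAt (relabel S T) (relabelL S T) v :=
  (relabelL S T).hasFDerivAt

/-- Relabelled phase vectors are phase vectors (reality and transversality are modewise). -/
theorem relabel_mem_galerkinSubspace {S T : Finset (Fin 3 → ℤ)} (hS : ∀ k ∈ S, -k ∈ S)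
    {v : ↥S → EuclideanSpace ℂ (Fin 3)} (hv : v ∈ galerkinSubspace S) :
    relabel S T v ∈ galerkinSubspace T := by
  refine ⟨isRealCoeff_restrict (hv.1.isConjSymm_coeffExt hS), fun k => ?_⟩
  show ∑ j, ((k : Fin 3 → ℤ) j : ℂ) * coeffExt S v (k : Fin 3 → ℤ) j = 0
  by_cases hk : (k : Fin 3 → ℤ) ∈ S
  · rw [coeffExt_of_mem v hk]
    exact hv.2 ⟨k, hk⟩
  · simp [coeffExt_of_not_mem v hk]

/-- Relabelling on phase spaces. -/
def relabelPhase {S : Finset (Fin 3 → ℤ)} (hS : ∀ k ∈ S, -k ∈ S) (T : Finset (Fin 3 → ℤ))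
    (x : ↥(galerkinSubspace S)) : ↥(galerkinSubspace T) :=
  ⟨relabel S T x, relabel_mem_galerkinSubspace hS x.2⟩

@[simp] theorem coe_relabelPhase {S : Finset (Fin 3 → ℤ)} (hS : ∀ k ∈ S, -k ∈ S) (T : Finset (Fin 3 → ℤ))
    (x : ↥(galerkinSubspace S)) :
    ((relabelPhase hS T x : ↥(galerkinSubspace T)) : ↥T → EuclideanSpace ℂ (Fin 3)) = relabel S T x := rfl

theorem continuous_relabelPhase {S : Finset (Fin 3 → ℤ)} (hS : ∀ k ∈ S, -k ∈ S) (T : Finset (Fin 3 → ℤ)) :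
    Continuous (relabelPhase hS T) :=
  ((continuous_relabel S T).comp continuous_subtype_val).subtype_mk _


/-- The coupling majorant is antitone in the level. -/
theorem cpl_mono {ν A θ : ℝ} (hν : 0 ≤ ν) (hA : 0 ≤ A) (hθ : 0 ≤ θ) (hθ1 : θ ≤ 1) {m₀ m : ℕ} (hm : m₀ ≤ m)
    (k : Fin 3 → ℤ) : cpl ν A θ m k ≤ cpl ν A θ m₀ k := by
  rw [cpl_eq, cpl_eq, div_eq_mul_inv, div_eq_mul_inv]
  have hmax : max (l1 k) m₀ ≤ max (l1 k) m := max_le_max le_rfl hm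
  have h1 : θ ^ (max (l1 k) m) ≤ θ ^ (max (l1 k) m₀) := pow_le_pow_of_le_one hθ hθ1 hmax
  have h2 : ((1 + ((max (l1 k) m : ℕ) : ℝ)) ^ 4)⁻¹ ≤ ((1 + ((max (l1 k) m₀ : ℕ) : ℝ)) ^ 4)⁻¹ := by
    refine inv_anti₀ (by positivity) (pow_le_pow_left₀ (by positivity) ?_ 4)
    have : ((max (l1 k) m₀ : ℕ) : ℝ) ≤ ((max (l1 k) m : ℕ) : ℝ) := by exact_mod_cast hmax
    linarith
  have h3 : 0 ≤ θ ^ (max (l1 k) m₀) := pow_nonneg hθ _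
  calc ν * A * θ ^ max (l1 k) m * ((1 + ((max (l1 k) m : ℕ) : ℝ)) ^ 4)⁻¹
      ≤ ν * A * θ ^ max (l1 k) m₀ * ((1 + ((max (l1 k) m₀ : ℕ) : ℝ)) ^ 4)⁻¹ := by gcongr

/-- On the profile, the level-`m` majorant is `≤ ν (1+|k|₁)² prof(k)`. -/
theorem cpl_le_prof {ν A θ : ℝ} (hν : 0 ≤ ν) (hA : 0 ≤ A) (hθ : 0 ≤ θ) (hθ1 : θ ≤ 1) (m : ℕ) (k : Fin 3 → ℤ) :
    cpl ν A θ m k ≤ ν * (1 + ((l1 k : ℕ) : ℝ)) ^ 2 * prof A θ k := by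
  rw [cpl_eq, prof_eq]
  set L : ℝ := ((l1 k : ℕ) : ℝ) with hL
  have hmax : l1 k ≤ max (l1 k) m := le_max_left _ _
  have h1 : θ ^ (max (l1 k) m) ≤ θ ^ (l1 k) := pow_le_pow_of_le_one hθ hθ1 hmax
  have hLm : L ≤ ((max (l1 k) m : ℕ) : ℝ) := by rw [hL]; exact_mod_cast hmax
  have hL0 : 0 ≤ L := by rw [hL]; positivity
  have h2 : ((1 + ((max (l1 k) m : ℕ) : ℝ)) ^ 4)⁻¹ ≤ ((1 + L) ^ 4)⁻¹ :=
    inv_anti₀ (by positivity) (pow_le_pow_left₀ (by positivity) (by linarith) 4)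
  have e : ν * (1 + L) ^ 2 * (A * θ ^ l1 k / (1 + L) ^ 6) = ν * A * θ ^ l1 k * ((1 + L) ^ 4)⁻¹ := by
    field_simp
  rw [e, div_eq_mul_inv]
  have h3 : 0 ≤ θ ^ (l1 k) := pow_nonneg hθ _
  gcongr

/-! # PART D — the extended block at level `m` -/

section Ext

/-- The shell modes of order `m` above level `m₀`. -/
def Shell (m₀ m : ℕ) : Type :=
  {k : ↥(freqBall m : Finset (Fin 3 → ℤ)) // ((m₀ : ℕ) : ℝ) ^ 2 < freqNormSq (k : Fin 3 → ℤ)}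

instance instFintypeShell (m₀ m : ℕ) : Fintype (Shell m₀ m) := by
  unfold Shell; infer_instance

/-- An enumeration of the shell modes. -/
def shellEnum (m₀ m : ℕ) : Fin (Fintype.card (Shell m₀ m)) ≃ Shell m₀ m :=
  (Fintype.equivFin (Shell m₀ m)).symm

/-- The Galerkin vector field of order `m` driven by `f`. -/
def fld (ν : ℝ) (f : UnitAddTorus (Fin 3) → EuclideanSpace ℝ (Fin 3)) (m : ℕ) (y : Coef m) : Coef m :=
  galerkinRHS (freqBall m : Finset (Fin 3 → ℤ)) ν (fourierRestrict (freqBall m : Finset (Fin 3 → ℤ)) f) y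

theorem continuous_fld (ν : ℝ) (f : UnitAddTorus (Fin 3) → EuclideanSpace ℝ (Fin 3)) (m : ℕ) :
    Continuous (fld ν f m) := by
  unfold fld
  exact (continuous_galerkinRHS ν).comp₂ continuous_const continuous_id

variable (ν : ℝ) (f : UnitAddTorus (Fin 3) → EuclideanSpace ℝ (Fin 3)) (A θ : ℝ) (m₀ m : ℕ) {n : ℕ}
  (h : Fin n → Coef m₀ → ℝ) (h' : Fin n → Coef m₀ → (Coef m₀ →L[ℝ] ℝ))

/-- The extended faces on the coefficient space of order `m`: OLD faces `h i ∘ P` (`Sum.inl`), SHELL faces the per-mode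
boxes `prof(k)² − ‖y k‖²`, `m₀² < |k|² ≤ m²` (`Sum.inr`). -/
def extFace : Fin n ⊕ Fin (Fintype.card (Shell m₀ m)) → Coef m → ℝ :=
  Sum.elim (fun i y => h i (relabel (freqBall m) (freqBall m₀) y))
    (fun j y => prof A θ ((shellEnum m₀ m j).1 : Fin 3 → ℤ) ^ 2 - ‖y (shellEnum m₀ m j).1‖ ^ 2)

/-- Their Fréchet derivatives. -/
def extDeriv : Fin n ⊕ Fin (Fintype.card (Shell m₀ m)) → Coef m → (Coef m →L[ℝ] ℝ) :=
  Sum.elim (fun i y => (h' i (relabel (freqBall m) (freqBall m₀) y)).comp (relabelL (freqBall m) (freqBall m₀)))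
    (fun j y => -(fderiv ℝ (fun z : Coef m => ‖z (shellEnum m₀ m j).1‖ ^ 2) y))

/-- The coordinate `y ↦ y k` is smooth, hence so is `y ↦ ‖y k‖²`. -/
theorem contDiff_norm_sq_apply (k : ↥(freqBall m : Finset (Fin 3 → ℤ))) :
    ContDiff ℝ 1 (fun z : Coef m => ‖z k‖ ^ 2) :=
  ((ContinuousLinearMap.proj (R := ℝ) k : Coef m →L[ℝ] EuclideanSpace ℂ (Fin 3)).contDiff).norm_sq ℝ

theorem hasFDerivAt_norm_sq_apply (k : ↥(freqBall m : Finset (Fin 3 → ℤ))) (y : Coef m) :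
    HasFDerivAt (fun z : Coef m => ‖z k‖ ^ 2) (fderiv ℝ (fun z : Coef m => ‖z k‖ ^ 2) y) y :=
  ((contDiff_norm_sq_apply m k).differentiable one_ne_zero y).hasFDerivAt

theorem fderiv_norm_sq_apply_apply (k : ↥(freqBall m : Finset (Fin 3 → ℤ))) (y v : Coef m) :
    fderiv ℝ (fun z : Coef m => ‖z k‖ ^ 2) y v = 2 * (inner ℂ (y k) (v k)).re := by
  have h1 : HasFDerivAt (fun z : Coef m => z k) (ContinuousLinearMap.proj (R := ℝ) k) y := hasFDerivAt_apply k y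
  rw [h1.norm_sq.fderiv]
  simp only [smul_apply, ContinuousLinearMap.comp_apply, ContinuousLinearMap.proj_apply, innerSL_apply_apply,
    nsmul_eq_mul, Nat.cast_ofNat]
  rfl

@[simp] theorem extFace_inl (i : Fin n) (y : Coef m) :
    extFace A θ m₀ m h (Sum.inl i) y = h i (relabel (freqBall m) (freqBall m₀) y) := rfl

@[simp] theorem extFace_inr (j : Fin (Fintype.card (Shell m₀ m))) (y : Coef m) :
    extFace A θ m₀ m h (Sum.inr j) y = prof A θ ((shellEnum m₀ m j).1 : Fin 3 → ℤ) ^ 2 - ‖y (shellEnum m₀ m j).1‖ ^ 2 := rfl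

theorem extDeriv_inl_apply (i : Fin n) (y v : Coef m) :
    extDeriv m₀ m h' (Sum.inl i) y v = h' i (relabel (freqBall m) (freqBall m₀) y) (relabel (freqBall m) (freqBall m₀) v) := rfl

theorem extDeriv_inr_apply (j : Fin (Fintype.card (Shell m₀ m))) (y v : Coef m) :
    extDeriv m₀ m h' (Sum.inr j) y v = -(2 * (inner ℂ (y (shellEnum m₀ m j).1) (v (shellEnum m₀ m j).1)).re) := by
  simp only [extDeriv, Sum.elim_inr, neg_apply, fderiv_norm_sq_apply_apply]

/-! ### Regularity clauses -/

theorem hasFDerivAt_extFace (hfd : ∀ i y, HasFDerivAt (h i) (h' i y) y) :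
    ∀ i y, HasFDerivAt (extFace A θ m₀ m h i) (extDeriv m₀ m h' i y) y := by
  rintro (i | j) y
  · exact (hfd i _).comp y (hasFDerivAt_relabel (freqBall m) (freqBall m₀) y)
  · have h2 := hasFDerivAt_norm_sq_apply m (shellEnum m₀ m j).1 y
    have h3 := (hasFDerivAt_const (prof A θ ((shellEnum m₀ m j).1 : Fin 3 → ℤ) ^ 2) y).sub h2
    refine h3.congr_fderiv ?_
    rw [zero_sub]
    rfl

theorem continuous_extDeriv (hh' : ∀ i, Continuous (h' i)) : ∀ i, Continuous (extDeriv m₀ m h' i) := by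
  rintro (i | j)
  · exact ((hh' i).comp (continuous_relabel _ _)).clm_comp continuous_const
  · show Continuous (fun y : Coef m => -(fderiv ℝ (fun z : Coef m => ‖z (shellEnum m₀ m j).1‖ ^ 2) y))
    exact ((contDiff_norm_sq_apply m (shellEnum m₀ m j).1).continuous_fderiv one_ne_zero).neg

theorem continuous_extFace (hfd : ∀ i y, HasFDerivAt (h i) (h' i y) y) : ∀ i, Continuous (extFace A θ m₀ m h i) :=
  fun i => continuous_iff_continuousAt.2 fun y => (hasFDerivAt_extFace A θ m₀ m h h' hfd i y).continuousAt

end Ext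

/-! ## The clauses of the extended block -/

section Clauses

variable {ν : ℝ} {f : UnitAddTorus (Fin 3) → EuclideanSpace ℝ (Fin 3)} {A θ δ : ℝ} {m₀ m : ℕ} {n : ℕ}
  {h : Fin n → Coef m₀ → ℝ} {h' : Fin n → Coef m₀ → (Coef m₀ →L[ℝ] ℝ)}

/-- mean-zero coefficient vectors of order `n` (as a predicate on the coefficient vector). -/
abbrev MZ (n : ℕ) (y : Coef n) : Prop := ∀ k : ↥(freqBall n : Finset (Fin 3 → ℤ)), (k : Fin 3 → ℤ) = 0 → y k = 0

theorem symm_freqBall (n : ℕ) : ∀ k ∈ (freqBall n : Finset (Fin 3 → ℤ)), -k ∈ (freqBall n : Finset (Fin 3 → ℤ)) :=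
  neg_mem_freqBall_of_mem

/-- Restriction `P : Phase m → Phase m₀`. -/
abbrev restrP (m₀ m : ℕ) : Phase m → Phase m₀ := relabelPhase (symm_freqBall m) (freqBall m₀)

/-- Extension by zero `ι : Phase m₀ → Phase m`. -/
abbrev extI (m₀ m : ℕ) : Phase m₀ → Phase m := relabelPhase (symm_freqBall m₀) (freqBall m)

theorem restrP_extI (hm : m₀ ≤ m) (y : Phase m₀) : restrP m₀ m (extI m₀ m y) = y :=
  Subtype.ext (relabel_relabel_of_subset (freqBall_mono hm) _)

theorem relabel_add (S T : Finset (Fin 3 → ℤ)) (v w : ↥S → EuclideanSpace ℂ (Fin 3)) :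
    relabel S T (v + w) = relabel S T v + relabel S T w :=
  (relabelₗ S T).map_add v w

/-- (L1) restriction of a point of the extended block lies in the old block. -/
theorem restr_mem (hm : m₀ ≤ m) {y : Phase m} (hy1 : ∀ i, 0 ≤ extFace A θ m₀ m h i y) (hy2 : MZ m y) :
    (∀ i, 0 ≤ h i (restrP m₀ m y : Phase m₀)) ∧ MZ m₀ (restrP m₀ m y : Phase m₀) := by
  refine ⟨fun i => by simpa using hy1 (Sum.inl i), fun l hl => ?_⟩
  have hlN : (l : Fin 3 → ℤ) ∈ (freqBall m : Finset (Fin 3 → ℤ)) := freqBall_mono hm l.2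
  show relabel (freqBall m) (freqBall m₀) (y : Coef m) l = 0
  rw [relabel_apply_of_mem _ hlN]
  exact hy2 ⟨l, hlN⟩ hl

/-- (L2) the extended block lies in the profile box. -/
theorem box_mem (hm : m₀ ≤ m) (hA : 0 < A) (hθ : 0 < θ)
    (hBox₀ : ∀ y₀ : Phase m₀, (∀ i, 0 ≤ h i y₀) → MZ m₀ y₀ →
      ∀ k : ↥(freqBall m₀ : Finset (Fin 3 → ℤ)), ‖(y₀ : Coef m₀) k‖ ≤ prof A θ k)
    {y : Phase m} (hy1 : ∀ i, 0 ≤ extFace A θ m₀ m h i y) (hy2 : MZ m y) :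
    ∀ k : ↥(freqBall m : Finset (Fin 3 → ℤ)), ‖(y : Coef m) k‖ ≤ prof A θ k := by
  intro k
  by_cases hk : ((m₀ : ℕ) : ℝ) ^ 2 < freqNormSq (k : Fin 3 → ℤ)
  · set j := (shellEnum m₀ m).symm ⟨k, hk⟩ with hj
    have hface := hy1 (Sum.inr j)
    rw [extFace_inr, hj, Equiv.apply_symm_apply] at hface
    have hsq : ‖(y : Coef m) k‖ ^ 2 ≤ prof A θ k ^ 2 := by simpa using sub_nonneg.1 hface
    exact (pow_le_pow_iff_left₀ (norm_nonneg _) (prof_pos hA hθ _).le two_ne_zero).1 hsq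
  · have hkm : (k : Fin 3 → ℤ) ∈ (freqBall m₀ : Finset (Fin 3 → ℤ)) := mem_freqBall.2 (not_lt.1 hk)
    obtain ⟨h1, h2⟩ := restr_mem (A := A) (θ := θ) (h := h) hm hy1 hy2
    have := hBox₀ _ h1 h2 ⟨k, hkm⟩
    rw [coe_relabelPhase,
      relabel_apply_of_mem (k := (⟨(k : Fin 3 → ℤ), hkm⟩ : ↥(freqBall m₀ : Finset (Fin 3 → ℤ)))) (y : Coef m) k.2]
      at this
    exact this

/-- (L6) robust sign transfer at level `m₀` with the doubled majorant. -/
theorem neg_iff_neg_of_robust₂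
    (hRob₀ : ∀ y₀ : Phase m₀, (∀ i, 0 ≤ h i y₀) → MZ m₀ y₀ → ∀ i, h i y₀ = 0 →
      ∀ w₀ : Coef m₀, (∀ k : ↥(freqBall m₀ : Finset (Fin 3 → ℤ)), ‖w₀ k‖ ≤ 2 * cpl ν A θ m₀ k) →
        h' i y₀ (fld ν f m₀ y₀ + w₀) ≠ 0)
    {y₀ : Phase m₀} (hy1 : ∀ i, 0 ≤ h i y₀) (hy2 : MZ m₀ y₀) {i : Fin n} (hi : h i y₀ = 0) {w₀ : Coef m₀}
    (hw : ∀ k : ↥(freqBall m₀ : Finset (Fin 3 → ℤ)), ‖w₀ k‖ ≤ 2 * cpl ν A θ m₀ k) :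
    (h' i y₀ (fld ν f m₀ y₀ + w₀) < 0 ↔ h' i y₀ (fld ν f m₀ y₀) < 0) := by
  have hside : ∀ s ∈ Set.Icc (0 : ℝ) 1, h' i y₀ (fld ν f m₀ y₀) + s * h' i y₀ w₀ ≠ 0 := by
    intro s hs
    have hsw : ∀ k : ↥(freqBall m₀ : Finset (Fin 3 → ℤ)), ‖(s • w₀) k‖ ≤ 2 * cpl ν A θ m₀ k := by
      intro k
      rw [Pi.smul_apply, norm_smul, Real.norm_eq_abs, abs_of_nonneg hs.1]
      calc s * ‖w₀ k‖ ≤ 1 * ‖w₀ k‖ := by gcongr; exact hs.2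
        _ = ‖w₀ k‖ := one_mul _
        _ ≤ 2 * cpl ν A θ m₀ k := hw k
    have := hRob₀ y₀ hy1 hy2 i hi (s • w₀) hsw
    rwa [map_add, map_smul, smul_eq_mul] at this
  have key := neg_iff_neg_of_forall_add_mul_ne_zero hside
  have e : h' i y₀ (fld ν f m₀ y₀ + w₀) = h' i y₀ (fld ν f m₀ y₀) + h' i y₀ w₀ := map_add _ _ _
  rw [e]
  exact key

variable (hm : m₀ ≤ m) (hν : 0 < ν) (hA : 0 < A) (hθ : 0 < θ) (hθ1 : θ < 1)
  (hth2 : 768 * Real.pi * latC * A ≤ ν * ((m₀ : ℝ) + 1))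
  (hBox₀ : ∀ y₀ : Phase m₀, (∀ i, 0 ≤ h i y₀) → MZ m₀ y₀ →
      ∀ k : ↥(freqBall m₀ : Finset (Fin 3 → ℤ)), ‖(y₀ : Coef m₀) k‖ ≤ prof A θ k)
include hm hν hA hθ hθ1 hth2 hBox₀

/-- (L3) the actual coupling at a point of the extended block is below the level-`m₀` majorant. -/
theorem coupling_mem {y : Phase m} (hy1 : ∀ i, 0 ≤ extFace A θ m₀ m h i y) (hy2 : MZ m y) :
    ∀ k : ↥(freqBall m₀ : Finset (Fin 3 → ℤ)),
      ‖relabel (freqBall m) (freqBall m₀) (fld ν f m y) k - fld ν f m₀ (relabel (freqBall m) (freqBall m₀) (y : Coef m)) k‖ ≤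
        cpl ν A θ m₀ k :=
  fun k => coupling_clause hν hA hθ hθ1.le hm hth2 (y : Coef m) (box_mem hm hA hθ hBox₀ hy1 hy2) f k

/-- the total perturbation seen by an old face: coupling + level-`m` perturbation ≤ twice the level-`m₀` majorant. -/
theorem total_perturbation_le {y : Phase m} (hy1 : ∀ i, 0 ≤ extFace A θ m₀ m h i y) (hy2 : MZ m y)
    {w : Coef m} (hw : ∀ k : ↥(freqBall m : Finset (Fin 3 → ℤ)), ‖w k‖ ≤ cpl ν A θ m k) :
    ∀ k : ↥(freqBall m₀ : Finset (Fin 3 → ℤ)),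
      ‖(relabel (freqBall m) (freqBall m₀) (fld ν f m y) - fld ν f m₀ (relabel (freqBall m) (freqBall m₀) (y : Coef m)) +
          relabel (freqBall m) (freqBall m₀) w) k‖ ≤ 2 * cpl ν A θ m₀ k := by
  intro k
  have hkN : (k : Fin 3 → ℤ) ∈ (freqBall m : Finset (Fin 3 → ℤ)) := freqBall_mono hm k.2
  have h1 := coupling_mem (f := f) hm hν hA hθ hθ1 hth2 hBox₀ hy1 hy2 k
  have h2 : ‖relabel (freqBall m) (freqBall m₀) w k‖ ≤ cpl ν A θ m₀ k := by
    rw [relabel_apply_of_mem _ hkN]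
    exact (hw ⟨k, hkN⟩).trans (cpl_mono hν.le hA.le hθ.le hθ1.le hm _)
  calc ‖(relabel (freqBall m) (freqBall m₀) (fld ν f m y) - fld ν f m₀ (relabel (freqBall m) (freqBall m₀) (y : Coef m)) +
          relabel (freqBall m) (freqBall m₀) w) k‖
      ≤ ‖(relabel (freqBall m) (freqBall m₀) (fld ν f m y) - fld ν f m₀ (relabel (freqBall m) (freqBall m₀) (y : Coef m))) k‖ +
          ‖relabel (freqBall m) (freqBall m₀) w k‖ := norm_add_le _ _
    _ ≤ cpl ν A θ m₀ k + cpl ν A θ m₀ k := add_le_add h1 h2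
    _ = 2 * cpl ν A θ m₀ k := by ring

/-- (L4) OLD faces of the extended block are robustly transversal at level `m`. -/
theorem robust_inl
    (hRob₀ : ∀ y₀ : Phase m₀, (∀ i, 0 ≤ h i y₀) → MZ m₀ y₀ → ∀ i, h i y₀ = 0 →
      ∀ w₀ : Coef m₀, (∀ k : ↥(freqBall m₀ : Finset (Fin 3 → ℤ)), ‖w₀ k‖ ≤ 2 * cpl ν A θ m₀ k) →
        h' i y₀ (fld ν f m₀ y₀ + w₀) ≠ 0)
    {y : Phase m} (hy1 : ∀ i, 0 ≤ extFace A θ m₀ m h i y) (hy2 : MZ m y) (i : Fin n)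
    (hi : extFace A θ m₀ m h (Sum.inl i) y = 0)
    {w : Coef m} (hw : ∀ k : ↥(freqBall m : Finset (Fin 3 → ℤ)), ‖w k‖ ≤ cpl ν A θ m k) :
    extDeriv m₀ m h' (Sum.inl i) y (fld ν f m y + w) ≠ 0 := by
  obtain ⟨h1, h2⟩ := restr_mem (A := A) (θ := θ) (h := h) hm hy1 hy2
  rw [extFace_inl] at hi
  have htot := total_perturbation_le (f := f) hm hν hA hθ hθ1 hth2 hBox₀ hy1 hy2 hw
  have := hRob₀ (restrP m₀ m y) h1 h2 i hi _ htot
  rw [extDeriv_inl_apply, relabel_add]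
  have e : relabel (freqBall m) (freqBall m₀) (fld ν f m y) + relabel (freqBall m) (freqBall m₀) w =
      fld ν f m₀ (relabel (freqBall m) (freqBall m₀) (y : Coef m)) +
        (relabel (freqBall m) (freqBall m₀) (fld ν f m y) - fld ν f m₀ (relabel (freqBall m) (freqBall m₀) (y : Coef m)) +
          relabel (freqBall m) (freqBall m₀) w) := by abel
  rw [e]
  exact this

omit hm hν hA hθ hθ1 hth2 hBox₀ in
/-- Tail modes of the force vanish. -/
theorem force_shell_zero (hForce : ∀ k : Fin 3 → ℤ, ((m₀ : ℕ) : ℝ) ^ 2 < freqNormSq k →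
      UnitAddTorus.mFourierCoeff (EuclideanSpace.complexify ∘ f) k = 0)
    (j : Fin (Fintype.card (Shell m₀ m))) :
    fourierRestrict (freqBall m : Finset (Fin 3 → ℤ)) f (shellEnum m₀ m j).1 = 0 :=
  hForce _ (shellEnum m₀ m j).2

omit hm hth2 hBox₀ in
/-- The shell robustness inequality: `576 C A < π ν (m₀+1)`, `m₀² < |k|²` give
`192 π C A (1+|k|₁) + ν (1+|k|₁)² < 4π² ν |k|₂²`. -/
theorem shell_ineq (hth : 576 * latC * A < Real.pi * ν * ((m₀ : ℝ) + 1)) {k : Fin 3 → ℤ}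
    (hk : ((m₀ : ℕ) : ℝ) ^ 2 < freqNormSq k) :
    192 * Real.pi * latC * (A * (1 + ((l1 k : ℕ) : ℝ))) + ν * (1 + ((l1 k : ℕ) : ℝ)) ^ 2 <
      ν * (4 * Real.pi ^ 2 * freqNormSq k) := by
  have hA2 : 0 < 2 * A := by linarith
  have h1 := sweeping_ineq (A := 2 * A) hν hA2 (by linarith) hk
  set L : ℝ := ((l1 k : ℕ) : ℝ) with hL
  set Q : ℝ := freqNormSq k with hQ
  have hL1 : (m₀ : ℝ) + 1 ≤ L := by
    have := succ_le_l1_of_sq_lt hk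
    rw [hL]; exact_mod_cast this
  have hL0 : 1 ≤ L := le_trans (by linarith [Nat.cast_nonneg (α := ℝ) m₀]) hL1
  have hQ3 : L ^ 2 ≤ 3 * Q := l1_sq_le_three_mul_freqNormSq _
  have hpi : 3 < Real.pi := Real.pi_gt_three
  have e1 : ν * (1 + L) ^ 2 ≤ ν * (4 * L ^ 2) := by
    refine mul_le_mul_of_nonneg_left ?_ hν.le
    nlinarith
  have e2 : ν * (4 * L ^ 2) ≤ ν * (12 * Q) := by
    refine mul_le_mul_of_nonneg_left ?_ hν.le
    linarith
  have e3 : 192 * Real.pi * latC * (2 * A * (1 + L)) = 2 * (192 * Real.pi * latC * (A * (1 + L))) := by ring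
  have hQ0 : 0 < Q := lt_of_le_of_lt (by positivity) hk
  have hππ : 12 < 2 * Real.pi ^ 2 := by nlinarith
  have hkey : ν * (12 * Q) < ν * (2 * Real.pi ^ 2 * Q) := by
    have := mul_lt_mul_of_pos_right hππ (mul_pos hν hQ0)
    nlinarith
  have e4 : ν * (4 * Real.pi ^ 2 * Q) = 2 * (ν * (2 * Real.pi ^ 2 * Q)) := by ring
  rw [e3] at h1
  linarith

omit hth2 in
/-- (L5) SHELL faces of the extended block are robust strict ENTRANCE faces at level `m`. -/
theorem entrance_inr (hth : 576 * latC * A < Real.pi * ν * ((m₀ : ℝ) + 1))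
    (hForce : ∀ k : Fin 3 → ℤ, ((m₀ : ℕ) : ℝ) ^ 2 < freqNormSq k →
      UnitAddTorus.mFourierCoeff (EuclideanSpace.complexify ∘ f) k = 0)
    {y : Phase m} (hy1 : ∀ i, 0 ≤ extFace A θ m₀ m h i y) (hy2 : MZ m y)
    (j : Fin (Fintype.card (Shell m₀ m))) (hj : extFace A θ m₀ m h (Sum.inr j) y = 0)
    {w : Coef m} (hw : ∀ k : ↥(freqBall m : Finset (Fin 3 → ℤ)), ‖w k‖ ≤ cpl ν A θ m k) :
    0 < extDeriv m₀ m h' (Sum.inr j) y (fld ν f m y + w) := by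
  set k := (shellEnum m₀ m j).1 with hk
  have hkt : ((m₀ : ℕ) : ℝ) ^ 2 < freqNormSq (k : Fin 3 → ℤ) := (shellEnum m₀ m j).2
  rw [extFace_inr, ← hk] at hj
  have hbox := box_mem hm hA hθ hBox₀ hy1 hy2
  have hnorm : ‖(y : Coef m) k‖ = prof A θ k := by
    have hsq : ‖(y : Coef m) k‖ ^ 2 = prof A θ k ^ 2 := by linarith
    exact (pow_left_inj₀ (norm_nonneg _) (prof_pos hA hθ _).le two_ne_zero).1 hsq
  have hg : fourierRestrict (freqBall m : Finset (Fin 3 → ℤ)) f k = 0 := by rw [hk]; exact hForce _ (shellEnum m₀ m j).2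
  -- the field part
  have hF := re_inner_field_le (ν := ν) hA hθ hθ1.le (y : Coef m) (fourierRestrict (freqBall m : Finset (Fin 3 → ℤ)) f)
    hbox k hg hnorm
  -- the perturbation part
  set p : ℝ := prof A θ k with hp
  set L : ℝ := ((l1 (k : Fin 3 → ℤ) : ℕ) : ℝ) with hL
  have hp0 : 0 < p := prof_pos hA hθ _
  have hW : (inner ℂ ((y : Coef m) k) (w k)).re ≤ p * (ν * (1 + L) ^ 2 * p) := by
    refine ((Complex.re_le_norm _).trans (norm_inner_le_norm _ _)).trans ?_
    rw [hnorm]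
    exact mul_le_mul_of_nonneg_left ((hw k).trans (cpl_le_prof hν.le hA.le hθ.le hθ1.le m k)) hp0.le
  have hineq := shell_ineq hν hA hθ hθ1 hth hkt
  rw [extDeriv_inr_apply, ← hk]
  have esplit : (inner ℂ ((y : Coef m) k) ((fld ν f m y + w) k)).re =
      (inner ℂ ((y : Coef m) k) (fld ν f m y k)).re + (inner ℂ ((y : Coef m) k) (w k)).re := by
    rw [Pi.add_apply, inner_add_right, Complex.add_re]
  rw [esplit]
  have hF' : (inner ℂ ((y : Coef m) k) (fld ν f m (y : Coef m) k)).re ≤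
      p ^ 2 * (192 * Real.pi * latC * (A * (1 + L)) - ν * (4 * Real.pi ^ 2 * freqNormSq (k : Fin 3 → ℤ))) := hF
  have h3 : p ^ 2 * (192 * Real.pi * latC * (A * (1 + L)) - ν * (4 * Real.pi ^ 2 * freqNormSq (k : Fin 3 → ℤ))) +
      p * (ν * (1 + L) ^ 2 * p) < 0 := by
    have : p ^ 2 * (192 * Real.pi * latC * (A * (1 + L)) - ν * (4 * Real.pi ^ 2 * freqNormSq (k : Fin 3 → ℤ))) +
        p * (ν * (1 + L) ^ 2 * p) =
        p ^ 2 * (192 * Real.pi * latC * (A * (1 + L)) + ν * (1 + L) ^ 2 - ν * (4 * Real.pi ^ 2 * freqNormSq (k : Fin 3 → ℤ))) := by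
      ring
    rw [this]
    exact mul_neg_of_pos_of_neg (pow_pos hp0 2) (by linarith)
  have : (inner ℂ ((y : Coef m) k) (fld ν f m (y : Coef m) k)).re + (inner ℂ ((y : Coef m) k) (w k)).re < 0 := by
    linarith
  linarith

/-- (L7) Non-retraction lifts from level `m₀` to level `m` (sets indexed by the Sum type). -/
theorem not_retract_ext (hth : 576 * latC * A < Real.pi * ν * ((m₀ : ℝ) + 1))
    (hForce : ∀ k : Fin 3 → ℤ, ((m₀ : ℕ) : ℝ) ^ 2 < freqNormSq k →
      UnitAddTorus.mFourierCoeff (EuclideanSpace.complexify ∘ f) k = 0)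
    (hRob₀ : ∀ y₀ : Phase m₀, (∀ i, 0 ≤ h i y₀) → MZ m₀ y₀ → ∀ i, h i y₀ = 0 →
      ∀ w₀ : Coef m₀, (∀ k : ↥(freqBall m₀ : Finset (Fin 3 → ℤ)), ‖w₀ k‖ ≤ 2 * cpl ν A θ m₀ k) →
        h' i y₀ (fld ν f m₀ y₀ + w₀) ≠ 0)
    (hnr₀ : ¬ ∃ r : Phase m₀ → Phase m₀,
      ContinuousOn r {y₀ | (∀ i, 0 ≤ h i y₀) ∧ MZ m₀ y₀} ∧
      MapsTo r {y₀ | (∀ i, 0 ≤ h i y₀) ∧ MZ m₀ y₀}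
        {y₀ | ((∀ i, 0 ≤ h i y₀) ∧ MZ m₀ y₀) ∧ ∃ i, h i y₀ = 0 ∧ h' i y₀ (fld ν f m₀ y₀) < 0} ∧
      ∀ y₀ ∈ {y₀ : Phase m₀ | ((∀ i, 0 ≤ h i y₀) ∧ MZ m₀ y₀) ∧ ∃ i, h i y₀ = 0 ∧ h' i y₀ (fld ν f m₀ y₀) < 0},
        r y₀ = y₀) :
    ¬ ∃ r : Phase m → Phase m,
      ContinuousOn r {y | (∀ i, 0 ≤ extFace A θ m₀ m h i y) ∧ MZ m y} ∧
      MapsTo r {y | (∀ i, 0 ≤ extFace A θ m₀ m h i y) ∧ MZ m y}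
        {y | ((∀ i, 0 ≤ extFace A θ m₀ m h i y) ∧ MZ m y) ∧
          ∃ i, extFace A θ m₀ m h i y = 0 ∧ extDeriv m₀ m h' i y (fld ν f m y) < 0} ∧
      ∀ y ∈ {y : Phase m | ((∀ i, 0 ≤ extFace A θ m₀ m h i y) ∧ MZ m y) ∧
          ∃ i, extFace A θ m₀ m h i y = 0 ∧ extDeriv m₀ m h' i y (fld ν f m y) < 0}, r y = y := by
  -- membership of ι y₀ in the extended block
  have hιB : ∀ y₀ : Phase m₀, (∀ i, 0 ≤ h i y₀) → MZ m₀ y₀ →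
      (∀ i, 0 ≤ extFace A θ m₀ m h i (extI m₀ m y₀)) ∧ MZ m (extI m₀ m y₀) := by
    intro y₀ hy1 hy2
    refine ⟨?_, fun k hk => ?_⟩
    · rintro (i | j)
      · rw [extFace_inl, coe_relabelPhase, relabel_relabel_of_subset (freqBall_mono hm)]
        exact hy1 i
      · rw [extFace_inr, coe_relabelPhase,
          relabel_apply_of_not_mem _ (not_mem_freqBall.2 (shellEnum m₀ m j).2), norm_zero,
          zero_pow two_ne_zero, sub_zero]
        positivity
    · rw [coe_relabelPhase, relabel_apply, hk, coeffExt_of_mem _ (zero_mem_freqBall m₀)]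
      exact hy2 ⟨0, zero_mem_freqBall m₀⟩ rfl
  refine not_retract_of_section (extI m₀ m) (restrP m₀ m) (continuous_relabelPhase _ _)
    (continuous_relabelPhase _ _) (restrP_extI hm) ?_ ?_ ?_ hnr₀
  · rintro y₀ ⟨hy1, hy2⟩
    exact hιB y₀ hy1 hy2
  · -- ι maps the old exit set into the extended exit set
    rintro y₀ ⟨⟨hy1, hy2⟩, i, hi, hneg⟩
    obtain ⟨hB1, hB2⟩ := hιB y₀ hy1 hy2
    refine ⟨⟨hB1, hB2⟩, Sum.inl i, ?_, ?_⟩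
    · rw [extFace_inl, coe_relabelPhase, relabel_relabel_of_subset (freqBall_mono hm)]
      exact hi
    · have hc := coupling_mem (f := f) hm hν hA hθ hθ1 hth2 hBox₀ hB1 hB2
      simp only [coe_relabelPhase, relabel_relabel_of_subset (freqBall_mono hm)] at hc
      have hc2 : ∀ k : ↥(freqBall m₀ : Finset (Fin 3 → ℤ)),
          ‖(relabel (freqBall m) (freqBall m₀) (fld ν f m (relabel (freqBall m₀) (freqBall m) (y₀ : Coef m₀))) -
              fld ν f m₀ (y₀ : Coef m₀)) k‖ ≤ 2 * cpl ν A θ m₀ k := by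
        intro k
        have := hc k
        have h0 : 0 ≤ cpl ν A θ m₀ k := by rw [cpl_eq]; positivity
        rw [Pi.sub_apply]
        linarith
      have key := (neg_iff_neg_of_robust₂ hRob₀ hy1 hy2 hi hc2).2 hneg
      rw [extDeriv_inl_apply, coe_relabelPhase, relabel_relabel_of_subset (freqBall_mono hm)]
      convert key using 2
      abel
  · -- P maps the extended exit set into the old exit set
    rintro y ⟨⟨hy1, hy2⟩, i, hi, hneg⟩
    obtain ⟨h1, h2⟩ := restr_mem (A := A) (θ := θ) (h := h) hm hy1 hy2
    rcases i with i | j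
    · refine ⟨⟨h1, h2⟩, i, ?_, ?_⟩
      · rw [extFace_inl] at hi; exact hi
      · rw [extFace_inl] at hi
        have hc := coupling_mem (f := f) hm hν hA hθ hθ1 hth2 hBox₀ hy1 hy2
        have hc2 : ∀ k : ↥(freqBall m₀ : Finset (Fin 3 → ℤ)),
            ‖(relabel (freqBall m) (freqBall m₀) (fld ν f m y) -
              fld ν f m₀ (relabel (freqBall m) (freqBall m₀) (y : Coef m))) k‖ ≤ 2 * cpl ν A θ m₀ k := by
          intro k
          have := hc k
          have h0 : 0 ≤ cpl ν A θ m₀ k := by rw [cpl_eq]; positivity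
          rw [Pi.sub_apply]
          linarith
        rw [extDeriv_inl_apply] at hneg
        have hneg' : h' i (relabel (freqBall m) (freqBall m₀) (y : Coef m))
            (fld ν f m₀ (relabel (freqBall m) (freqBall m₀) (y : Coef m)) +
              (relabel (freqBall m) (freqBall m₀) (fld ν f m y) -
                fld ν f m₀ (relabel (freqBall m) (freqBall m₀) (y : Coef m)))) < 0 := by
          convert hneg using 2; abel
        exact (neg_iff_neg_of_robust₂ hRob₀ h1 h2 hi hc2).1 hneg'
    · -- a shell face cannot be an exit face
      exfalso
      have hpos := entrance_inr (h' := h') hm hν hA hθ hθ1 hBox₀ hth hForce hy1 hy2 j hi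
        (w := 0) (fun k => by rw [Pi.zero_apply, norm_zero, cpl_eq]; positivity)
      rw [add_zero] at hpos
      exact lt_irrefl _ (hneg.trans hpos)

omit hν hth2 in
/-- (L8) the extended block lies in the window with slack `δ`. -/
theorem window_mem {E ε₀ : ℝ} {G : ℝ≥0}
    (hEncl₀ : ∀ y₀ : Phase m₀, (∀ i, 0 ≤ h i y₀) → MZ m₀ y₀ →
      2⁻¹ * ∑ k, ‖(y₀ : Coef m₀) k‖ ^ 2 + 2 * δ ≤ E ∧
      ε₀ ≤ ∑ k, (inner ℂ (fourierRestrict (freqBall m₀ : Finset (Fin 3 → ℤ)) f k) ((y₀ : Coef m₀) k)).re ∧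
      4 * Real.pi ^ 2 * ∑ k, freqNormSq ((k : ↥(freqBall m₀ : Finset (Fin 3 → ℤ))) : Fin 3 → ℤ) *
        ‖(y₀ : Coef m₀) k‖ ^ 2 + 2 * δ ≤ (G : ℝ))
    (hForce : ∀ k : Fin 3 → ℤ, ((m₀ : ℕ) : ℝ) ^ 2 < freqNormSq k →
      UnitAddTorus.mFourierCoeff (EuclideanSpace.complexify ∘ f) k = 0)
    (htail : 2⁻¹ * (A ^ 2 * θ ^ (2 * m₀) * latC) ≤ δ ∧ 4 * Real.pi ^ 2 * (A ^ 2 * θ ^ (2 * m₀) * latC) ≤ δ)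
    {y : Phase m} (hy1 : ∀ i, 0 ≤ extFace A θ m₀ m h i y) (hy2 : MZ m y) :
    2⁻¹ * ∑ k, ‖(y : Coef m) k‖ ^ 2 + δ ≤ E ∧
      ε₀ ≤ ∑ k, (inner ℂ (fourierRestrict (freqBall m : Finset (Fin 3 → ℤ)) f k) ((y : Coef m) k)).re ∧
      4 * Real.pi ^ 2 * ∑ k, freqNormSq ((k : ↥(freqBall m : Finset (Fin 3 → ℤ))) : Fin 3 → ℤ) *
        ‖(y : Coef m) k‖ ^ 2 + δ ≤ (G : ℝ) := by
  obtain ⟨h1, h2⟩ := restr_mem (A := A) (θ := θ) (h := h) hm hy1 hy2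
  obtain ⟨hE, hW, hZ⟩ := hEncl₀ _ h1 h2
  have hbox := box_mem hm hA hθ hBox₀ hy1 hy2
  obtain ⟨tE, tZ⟩ := tail_sums_le hA.le hθ.le hθ1.le hm (y : Coef m) hbox
  have eE : ∑ l : ↥(freqBall m₀ : Finset (Fin 3 → ℤ)), ‖coeffExt (freqBall m) (y : Coef m) (l : Fin 3 → ℤ)‖ ^ 2 =
      ∑ l : ↥(freqBall m₀ : Finset (Fin 3 → ℤ)), ‖((restrP m₀ m y : Phase m₀) : Coef m₀) l‖ ^ 2 := rfl
  have eZ : ∑ l : ↥(freqBall m₀ : Finset (Fin 3 → ℤ)),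
        freqNormSq (l : Fin 3 → ℤ) * ‖coeffExt (freqBall m) (y : Coef m) (l : Fin 3 → ℤ)‖ ^ 2 =
      ∑ l : ↥(freqBall m₀ : Finset (Fin 3 → ℤ)), freqNormSq ((l : ↥(freqBall m₀ : Finset (Fin 3 → ℤ))) : Fin 3 → ℤ) *
        ‖((restrP m₀ m y : Phase m₀) : Coef m₀) l‖ ^ 2 := rfl
  have eW : ∑ k : ↥(freqBall m : Finset (Fin 3 → ℤ)),
      (inner ℂ (fourierRestrict (freqBall m : Finset (Fin 3 → ℤ)) f k) ((y : Coef m) k)).re =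
      ∑ l : ↥(freqBall m₀ : Finset (Fin 3 → ℤ)),
        (inner ℂ (fourierRestrict (freqBall m₀ : Finset (Fin 3 → ℤ)) f l) (((restrP m₀ m y : Phase m₀) : Coef m₀) l)).re +
      ∑ k : ↥(freqBall m : Finset (Fin 3 → ℤ)),
        (if ((m₀ : ℕ) : ℝ) ^ 2 < freqNormSq (k : Fin 3 → ℤ) then
          (inner ℂ (fourierRestrict (freqBall m : Finset (Fin 3 → ℤ)) f k) ((y : Coef m) k)).re else 0) := by
    have := sum_freqBall_split hm
      (fun k => (inner ℂ (UnitAddTorus.mFourierCoeff (EuclideanSpace.complexify ∘ f) k)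
        (coeffExt (freqBall m) (y : Coef m) k)).re)
    simpa only [coeffExt_coe, coe_relabelPhase, relabel_apply, fourierRestrict_apply] using this
  have hWt : ∑ k : ↥(freqBall m : Finset (Fin 3 → ℤ)),
      (if ((m₀ : ℕ) : ℝ) ^ 2 < freqNormSq (k : Fin 3 → ℤ) then
        (inner ℂ (fourierRestrict (freqBall m : Finset (Fin 3 → ℤ)) f k) ((y : Coef m) k)).re else 0) = 0 := by
    refine Finset.sum_eq_zero fun k _ => ?_
    split_ifs with hk
    · rw [fourierRestrict_apply, hForce _ hk, inner_zero_left, Complex.zero_re]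
    · rfl
  refine ⟨?_, ?_, ?_⟩
  · rw [eE] at tE; linarith [htail.1]
  · rw [eW, hWt, add_zero]; exact hW
  · rw [eZ] at tZ; linarith [htail.2]

end Clauses

/-! ## The faces re-indexed by `Fin (n + #shell)` and the five clauses in the filed shape -/

section Final

variable (ν : ℝ) (f : UnitAddTorus (Fin 3) → EuclideanSpace ℝ (Fin 3)) (A θ : ℝ) (m₀ m : ℕ) {n : ℕ}
  (h : Fin n → Coef m₀ → ℝ) (h' : Fin n → Coef m₀ → (Coef m₀ →L[ℝ] ℝ))

/-- The extended faces indexed by `Fin (n + #shell)`. -/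
def extFaceN (i : Fin (n + Fintype.card (Shell m₀ m))) : Coef m → ℝ :=
  extFace A θ m₀ m h (finSumFinEquiv.symm i)

/-- Their derivatives. -/
def extDerivN (i : Fin (n + Fintype.card (Shell m₀ m))) : Coef m → (Coef m →L[ℝ] ℝ) :=
  extDeriv m₀ m h' (finSumFinEquiv.symm i)

variable {ν f A θ m₀ m h h'}

theorem facesN_iff (y : Coef m) :
    (∀ i, 0 ≤ extFaceN A θ m₀ m h i y) ↔ ∀ i', 0 ≤ extFace A θ m₀ m h i' y := by
  constructor
  · intro H i'
    have := H (finSumFinEquiv i')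
    simpa [extFaceN] using this
  · intro H i
    exact H _

theorem existsN_iff (_y : Coef m) (P : (Coef m → ℝ) → (Coef m → (Coef m →L[ℝ] ℝ)) → Prop) :
    (∃ i, P (extFaceN A θ m₀ m h i) (extDerivN m₀ m h' i)) ↔
      ∃ i', P (extFace A θ m₀ m h i') (extDeriv m₀ m h' i') := by
  constructor
  · rintro ⟨i, hi⟩; exact ⟨_, hi⟩
  · rintro ⟨i', hi'⟩
    refine ⟨finSumFinEquiv i', ?_⟩
    simpa [extFaceN, extDerivN] using hi'

end Final

/-! ## S2 `BoxExtensionUpward` — PROVED -/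

/-- **S2 (`BoxExtensionUpward`) of the birth skeleton of piece P1 — PROVED.** A robust loud polyfacial block of the
order-`m₀` Galerkin system at an explicit sweeping level `m₀` (`10⁵ A ≤ ν (m₀+1)`, `10⁴ A² θ^{2m₀} ≤ δ`, `mf ≤ m₀`) with
DOUBLED robustness and window slack extends to every level `m ≥ m₀`: old faces ∘ restriction + per-mode Gevrey boxes for
the shell `m₀² < |k|² ≤ m²`. -/
theorem stub_boxExtensionUpward :
    ∀ (ν : ℝ) (mf : ℕ) (f : UnitAddTorus (Fin 3) → EuclideanSpace ℝ (Fin 3)) (E ε₀ A θ δ : ℝ) (G : ℝ≥0) (m₀ : ℕ),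
      0 < ν → 0 < A → 0 < θ → θ < 1 → 0 < δ →
      (∀ k : Fin 3 → ℤ, ((mf : ℕ) : ℝ) ^ 2 < freqNormSq k →
          UnitAddTorus.mFourierCoeff (EuclideanSpace.complexify ∘ f) k = 0) →
      mf ≤ m₀ → (10 : ℝ) ^ 5 * A ≤ ν * ((m₀ : ℝ) + 1) → (10 : ℝ) ^ 4 * A ^ 2 * θ ^ (2 * m₀) ≤ δ →
      (∃ (n : ℕ) (h : Fin n → (↥(freqBall m₀ : Finset (Fin 3 → ℤ)) → EuclideanSpace ℂ (Fin 3)) → ℝ)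
            (h' : Fin n → (↥(freqBall m₀ : Finset (Fin 3 → ℤ)) → EuclideanSpace ℂ (Fin 3)) →
              ((↥(freqBall m₀ : Finset (Fin 3 → ℤ)) → EuclideanSpace ℂ (Fin 3)) →L[ℝ] ℝ)),
            (∀ i y, HasFDerivAt (h i) (h' i y) y) ∧ (∀ i, Continuous (h' i)) ∧
            (∀ y : ↥(galerkinSubspace (freqBall m₀ : Finset (Fin 3 → ℤ))),
                (∀ i, 0 ≤ h i y) → (∀ k : ↥(freqBall m₀ : Finset (Fin 3 → ℤ)), (k : Fin 3 → ℤ) = 0 →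
                  (y : ↥(freqBall m₀ : Finset (Fin 3 → ℤ)) → EuclideanSpace ℂ (Fin 3)) k = 0) →
                ∀ i, h i y = 0 → ∀ w : ↥(freqBall m₀ : Finset (Fin 3 → ℤ)) → EuclideanSpace ℂ (Fin 3),
                  (∀ k : ↥(freqBall m₀ : Finset (Fin 3 → ℤ)), ‖w k‖ ≤ 2 * (ν * A * θ ^ (max (∑ j, ((k : Fin 3 → ℤ) j).natAbs) m₀) /
                    (1 + ((max (∑ j, ((k : Fin 3 → ℤ) j).natAbs) m₀ : ℕ) : ℝ)) ^ 4)) →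
                  h' i y (galerkinRHS (freqBall m₀ : Finset (Fin 3 → ℤ)) ν (fourierRestrict (freqBall m₀ : Finset (Fin 3 → ℤ)) f) y + w) ≠ 0) ∧
            (¬ ∃ r : ↥(galerkinSubspace (freqBall m₀ : Finset (Fin 3 → ℤ))) → ↥(galerkinSubspace (freqBall m₀ : Finset (Fin 3 → ℤ))),
                ContinuousOn r {y | (∀ i, 0 ≤ h i y) ∧ ∀ k : ↥(freqBall m₀ : Finset (Fin 3 → ℤ)), (k : Fin 3 → ℤ) = 0 →
                  (y : ↥(freqBall m₀ : Finset (Fin 3 → ℤ)) → EuclideanSpace ℂ (Fin 3)) k = 0} ∧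
                MapsTo r {y | (∀ i, 0 ≤ h i y) ∧ ∀ k : ↥(freqBall m₀ : Finset (Fin 3 → ℤ)), (k : Fin 3 → ℤ) = 0 →
                  (y : ↥(freqBall m₀ : Finset (Fin 3 → ℤ)) → EuclideanSpace ℂ (Fin 3)) k = 0}
                  {y | ((∀ i, 0 ≤ h i y) ∧ ∀ k : ↥(freqBall m₀ : Finset (Fin 3 → ℤ)), (k : Fin 3 → ℤ) = 0 →
                    (y : ↥(freqBall m₀ : Finset (Fin 3 → ℤ)) → EuclideanSpace ℂ (Fin 3)) k = 0) ∧
                    ∃ i, h i y = 0 ∧ h' i y (galerkinRHS (freqBall m₀ : Finset (Fin 3 → ℤ)) ν (fourierRestrict (freqBall m₀ : Finset (Fin 3 → ℤ)) f) y) < 0} ∧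
                ∀ y ∈ {y : ↥(galerkinSubspace (freqBall m₀ : Finset (Fin 3 → ℤ))) | ((∀ i, 0 ≤ h i y) ∧ ∀ k : ↥(freqBall m₀ : Finset (Fin 3 → ℤ)), (k : Fin 3 → ℤ) = 0 →
                    (y : ↥(freqBall m₀ : Finset (Fin 3 → ℤ)) → EuclideanSpace ℂ (Fin 3)) k = 0) ∧
                    ∃ i, h i y = 0 ∧ h' i y (galerkinRHS (freqBall m₀ : Finset (Fin 3 → ℤ)) ν (fourierRestrict (freqBall m₀ : Finset (Fin 3 → ℤ)) f) y) < 0},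
                  r y = y) ∧
            (∀ y : ↥(galerkinSubspace (freqBall m₀ : Finset (Fin 3 → ℤ))),
                (∀ i, 0 ≤ h i y) → (∀ k : ↥(freqBall m₀ : Finset (Fin 3 → ℤ)), (k : Fin 3 → ℤ) = 0 →
                  (y : ↥(freqBall m₀ : Finset (Fin 3 → ℤ)) → EuclideanSpace ℂ (Fin 3)) k = 0) →
                (∀ k : ↥(freqBall m₀ : Finset (Fin 3 → ℤ)), ‖(y : ↥(freqBall m₀ : Finset (Fin 3 → ℤ)) → EuclideanSpace ℂ (Fin 3)) k‖ ≤
                    A * θ ^ (∑ i, ((k : Fin 3 → ℤ) i).natAbs) / (1 + ∑ i, (((k : Fin 3 → ℤ) i).natAbs : ℝ)) ^ 6) ∧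
                2⁻¹ * ∑ k, ‖(y : ↥(freqBall m₀ : Finset (Fin 3 → ℤ)) → EuclideanSpace ℂ (Fin 3)) k‖ ^ 2 + 2 * δ ≤ E ∧
                ε₀ ≤ ∑ k, (inner ℂ (fourierRestrict (freqBall m₀ : Finset (Fin 3 → ℤ)) f k)
                  ((y : ↥(freqBall m₀ : Finset (Fin 3 → ℤ)) → EuclideanSpace ℂ (Fin 3)) k)).re ∧
                4 * Real.pi ^ 2 * ∑ k, freqNormSq ((k : ↥(freqBall m₀ : Finset (Fin 3 → ℤ))) : Fin 3 → ℤ) *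
                  ‖(y : ↥(freqBall m₀ : Finset (Fin 3 → ℤ)) → EuclideanSpace ℂ (Fin 3)) k‖ ^ 2 + 2 * δ ≤ (G : ℝ))) →
      ∀ m : ℕ, m₀ ≤ m →
      ∃ (n : ℕ) (h : Fin n → (↥(freqBall m : Finset (Fin 3 → ℤ)) → EuclideanSpace ℂ (Fin 3)) → ℝ)
            (h' : Fin n → (↥(freqBall m : Finset (Fin 3 → ℤ)) → EuclideanSpace ℂ (Fin 3)) →
              ((↥(freqBall m : Finset (Fin 3 → ℤ)) → EuclideanSpace ℂ (Fin 3)) →L[ℝ] ℝ)),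
            (∀ i y, HasFDerivAt (h i) (h' i y) y) ∧ (∀ i, Continuous (h' i)) ∧
            (∀ y : ↥(galerkinSubspace (freqBall m : Finset (Fin 3 → ℤ))),
                (∀ i, 0 ≤ h i y) → (∀ k : ↥(freqBall m : Finset (Fin 3 → ℤ)), (k : Fin 3 → ℤ) = 0 →
                  (y : ↥(freqBall m : Finset (Fin 3 → ℤ)) → EuclideanSpace ℂ (Fin 3)) k = 0) →
                ∀ i, h i y = 0 → ∀ w : ↥(freqBall m : Finset (Fin 3 → ℤ)) → EuclideanSpace ℂ (Fin 3),
                  (∀ k : ↥(freqBall m : Finset (Fin 3 → ℤ)), ‖w k‖ ≤ ν * A * θ ^ (max (∑ j, ((k : Fin 3 → ℤ) j).natAbs) m) /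
                    (1 + ((max (∑ j, ((k : Fin 3 → ℤ) j).natAbs) m : ℕ) : ℝ)) ^ 4) →
                  h' i y (galerkinRHS (freqBall m : Finset (Fin 3 → ℤ)) ν (fourierRestrict (freqBall m : Finset (Fin 3 → ℤ)) f) y + w) ≠ 0) ∧
            (¬ ∃ r : ↥(galerkinSubspace (freqBall m : Finset (Fin 3 → ℤ))) → ↥(galerkinSubspace (freqBall m : Finset (Fin 3 → ℤ))),
                ContinuousOn r {y | (∀ i, 0 ≤ h i y) ∧ ∀ k : ↥(freqBall m : Finset (Fin 3 → ℤ)), (k : Fin 3 → ℤ) = 0 →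
                  (y : ↥(freqBall m : Finset (Fin 3 → ℤ)) → EuclideanSpace ℂ (Fin 3)) k = 0} ∧
                MapsTo r {y | (∀ i, 0 ≤ h i y) ∧ ∀ k : ↥(freqBall m : Finset (Fin 3 → ℤ)), (k : Fin 3 → ℤ) = 0 →
                  (y : ↥(freqBall m : Finset (Fin 3 → ℤ)) → EuclideanSpace ℂ (Fin 3)) k = 0}
                  {y | ((∀ i, 0 ≤ h i y) ∧ ∀ k : ↥(freqBall m : Finset (Fin 3 → ℤ)), (k : Fin 3 → ℤ) = 0 →
                    (y : ↥(freqBall m : Finset (Fin 3 → ℤ)) → EuclideanSpace ℂ (Fin 3)) k = 0) ∧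
                    ∃ i, h i y = 0 ∧ h' i y (galerkinRHS (freqBall m : Finset (Fin 3 → ℤ)) ν (fourierRestrict (freqBall m : Finset (Fin 3 → ℤ)) f) y) < 0} ∧
                ∀ y ∈ {y : ↥(galerkinSubspace (freqBall m : Finset (Fin 3 → ℤ))) | ((∀ i, 0 ≤ h i y) ∧ ∀ k : ↥(freqBall m : Finset (Fin 3 → ℤ)), (k : Fin 3 → ℤ) = 0 →
                    (y : ↥(freqBall m : Finset (Fin 3 → ℤ)) → EuclideanSpace ℂ (Fin 3)) k = 0) ∧
                    ∃ i, h i y = 0 ∧ h' i y (galerkinRHS (freqBall m : Finset (Fin 3 → ℤ)) ν (fourierRestrict (freqBall m : Finset (Fin 3 → ℤ)) f) y) < 0},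
                  r y = y) ∧
            (∀ y : ↥(galerkinSubspace (freqBall m : Finset (Fin 3 → ℤ))),
                (∀ i, 0 ≤ h i y) → (∀ k : ↥(freqBall m : Finset (Fin 3 → ℤ)), (k : Fin 3 → ℤ) = 0 →
                  (y : ↥(freqBall m : Finset (Fin 3 → ℤ)) → EuclideanSpace ℂ (Fin 3)) k = 0) →
                (∀ k : ↥(freqBall m : Finset (Fin 3 → ℤ)), ‖(y : ↥(freqBall m : Finset (Fin 3 → ℤ)) → EuclideanSpace ℂ (Fin 3)) k‖ ≤
                    A * θ ^ (∑ i, ((k : Fin 3 → ℤ) i).natAbs) / (1 + ∑ i, (((k : Fin 3 → ℤ) i).natAbs : ℝ)) ^ 6) ∧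
                2⁻¹ * ∑ k, ‖(y : ↥(freqBall m : Finset (Fin 3 → ℤ)) → EuclideanSpace ℂ (Fin 3)) k‖ ^ 2 + δ ≤ E ∧
                ε₀ ≤ ∑ k, (inner ℂ (fourierRestrict (freqBall m : Finset (Fin 3 → ℤ)) f k)
                  ((y : ↥(freqBall m : Finset (Fin 3 → ℤ)) → EuclideanSpace ℂ (Fin 3)) k)).re ∧
                4 * Real.pi ^ 2 * ∑ k, freqNormSq ((k : ↥(freqBall m : Finset (Fin 3 → ℤ))) : Fin 3 → ℤ) *
                  ‖(y : ↥(freqBall m : Finset (Fin 3 → ℤ)) → EuclideanSpace ℂ (Fin 3)) k‖ ^ 2 + δ ≤ (G : ℝ)) := by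
  intro ν mf f E ε₀ A θ δ G m₀ hν hA hθ hθ1 hδ hforce hmf hsw htl hblock m hm
  obtain ⟨n, h, h', hfd, hh', hrob₀, hnr₀, hencl₀⟩ := hblock
  -- thresholds from the explicit constants (`C ≤ 13`, `3 < π < 3.15`)
  have hC := latC_le
  have hC0 := latC_nonneg
  have hpi3 := Real.pi_gt_three
  have hpi := Real.pi_lt_d2
  have hm1 : (10 : ℝ) ^ 5 * A ≤ ν * ((m₀ : ℝ) + 1) := hsw
  have hth1 : 576 * latC * A < Real.pi * ν * ((m₀ : ℝ) + 1) := by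
    have e1 : 576 * latC * A ≤ 576 * 13 * A := by nlinarith
    have e2 : Real.pi * ν * ((m₀ : ℝ) + 1) ≥ 3 * ((10 : ℝ) ^ 5 * A) := by
      have := mul_le_mul hpi3.le hm1 (by positivity) (by positivity)
      linarith
    nlinarith
  have hth2 : 768 * Real.pi * latC * A ≤ ν * ((m₀ : ℝ) + 1) := by
    have e1 : 768 * Real.pi * latC * A ≤ 768 * 3.15 * 13 * A := by
      have : Real.pi * latC ≤ 3.15 * 13 := by nlinarith
      nlinarith
    nlinarith
  have hForce' : ∀ k : Fin 3 → ℤ, ((m₀ : ℕ) : ℝ) ^ 2 < freqNormSq k →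
      UnitAddTorus.mFourierCoeff (EuclideanSpace.complexify ∘ f) k = 0 := fun k hk =>
    hforce k (lt_of_le_of_lt (by exact_mod_cast Nat.pow_le_pow_left hmf 2) hk)
  have htail : 2⁻¹ * (A ^ 2 * θ ^ (2 * m₀) * latC) ≤ δ ∧ 4 * Real.pi ^ 2 * (A ^ 2 * θ ^ (2 * m₀) * latC) ≤ δ := by
    have h0 : 0 ≤ A ^ 2 * θ ^ (2 * m₀) := by positivity
    have e1 : A ^ 2 * θ ^ (2 * m₀) * latC ≤ 13 * (A ^ 2 * θ ^ (2 * m₀)) := by nlinarith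
    have e2 : Real.pi ^ 2 < 3.15 ^ 2 := by nlinarith
    constructor <;> nlinarith
  -- the level-`m₀` data in the shape of §Clauses
  have hBox₀ : ∀ y₀ : Phase m₀, (∀ i, 0 ≤ h i y₀) → MZ m₀ y₀ →
      ∀ k : ↥(freqBall m₀ : Finset (Fin 3 → ℤ)), ‖(y₀ : Coef m₀) k‖ ≤ prof A θ k :=
    fun y₀ h1 h2 => (hencl₀ y₀ h1 h2).1
  have hEncl₀ : ∀ y₀ : Phase m₀, (∀ i, 0 ≤ h i y₀) → MZ m₀ y₀ →
      2⁻¹ * ∑ k, ‖(y₀ : Coef m₀) k‖ ^ 2 + 2 * δ ≤ E ∧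
      ε₀ ≤ ∑ k, (inner ℂ (fourierRestrict (freqBall m₀ : Finset (Fin 3 → ℤ)) f k) ((y₀ : Coef m₀) k)).re ∧
      4 * Real.pi ^ 2 * ∑ k, freqNormSq ((k : ↥(freqBall m₀ : Finset (Fin 3 → ℤ))) : Fin 3 → ℤ) *
        ‖(y₀ : Coef m₀) k‖ ^ 2 + 2 * δ ≤ (G : ℝ) :=
    fun y₀ h1 h2 => (hencl₀ y₀ h1 h2).2
  have hRob₀ : ∀ y₀ : Phase m₀, (∀ i, 0 ≤ h i y₀) → MZ m₀ y₀ → ∀ i, h i y₀ = 0 →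
      ∀ w₀ : Coef m₀, (∀ k : ↥(freqBall m₀ : Finset (Fin 3 → ℤ)), ‖w₀ k‖ ≤ 2 * cpl ν A θ m₀ k) →
        h' i y₀ (fld ν f m₀ y₀ + w₀) ≠ 0 := hrob₀
  refine ⟨n + Fintype.card (Shell m₀ m), extFaceN A θ m₀ m h, extDerivN m₀ m h', ?_, ?_, ?_, ?_, ?_⟩
  · exact fun i y => hasFDerivAt_extFace A θ m₀ m h h' hfd _ y
  · exact fun i => continuous_extDeriv m₀ m h' hh' _
  · -- robust transversality at level m
    intro y hy1 hy2 i hi w hw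
    have hy1' := (facesN_iff (y : Coef m)).1 hy1
    unfold extFaceN at hi
    unfold extDerivN
    rcases hσ : (finSumFinEquiv.symm i : Fin n ⊕ Fin (Fintype.card (Shell m₀ m))) with i₀ | j
    · rw [hσ] at hi
      exact robust_inl hm hν hA hθ hθ1 hth2 hBox₀ hRob₀ hy1' hy2 i₀ hi hw
    · rw [hσ] at hi
      exact (entrance_inr hm hν hA hθ hθ1 hBox₀ hth1 hForce' hy1' hy2 j hi hw).ne'
  · -- no retraction onto the exit set
    have key := not_retract_ext (h' := h') hm hν hA hθ hθ1 hth2 hBox₀ hth1 hForce' hRob₀ hnr₀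
    have hB : {y : Phase m | (∀ i, 0 ≤ extFaceN A θ m₀ m h i y) ∧ MZ m y} =
        {y : Phase m | (∀ i, 0 ≤ extFace A θ m₀ m h i y) ∧ MZ m y} := by
      ext y; simp only [mem_setOf_eq, facesN_iff]
    have hE : {y : Phase m | ((∀ i, 0 ≤ extFaceN A θ m₀ m h i y) ∧ MZ m y) ∧
          ∃ i, extFaceN A θ m₀ m h i y = 0 ∧ extDerivN m₀ m h' i y (fld ν f m y) < 0} =
        {y : Phase m | ((∀ i, 0 ≤ extFace A θ m₀ m h i y) ∧ MZ m y) ∧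
          ∃ i, extFace A θ m₀ m h i y = 0 ∧ extDeriv m₀ m h' i y (fld ν f m y) < 0} := by
      ext y
      simp only [mem_setOf_eq, facesN_iff]
      rw [existsN_iff (y : Coef m) (fun F D => F y = 0 ∧ D y (fld ν f m y) < 0)]
    show ¬ ∃ r : Phase m → Phase m,
      ContinuousOn r {y : Phase m | (∀ i, 0 ≤ extFaceN A θ m₀ m h i y) ∧ MZ m y} ∧
      MapsTo r {y : Phase m | (∀ i, 0 ≤ extFaceN A θ m₀ m h i y) ∧ MZ m y}
        {y : Phase m | ((∀ i, 0 ≤ extFaceN A θ m₀ m h i y) ∧ MZ m y) ∧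
          ∃ i, extFaceN A θ m₀ m h i y = 0 ∧ extDerivN m₀ m h' i y (fld ν f m y) < 0} ∧
      ∀ y ∈ {y : Phase m | ((∀ i, 0 ≤ extFaceN A θ m₀ m h i y) ∧ MZ m y) ∧
          ∃ i, extFaceN A θ m₀ m h i y = 0 ∧ extDerivN m₀ m h' i y (fld ν f m y) < 0}, r y = y
    rw [hB, hE]
    exact key
  · -- enclosure
    intro y hy1 hy2
    have hy1' := (facesN_iff (y : Coef m)).1 hy1
    exact ⟨box_mem hm hA hθ hBox₀ hy1' hy2, window_mem hm hA hθ hθ1 hBox₀ hEncl₀ hForce' htail hy1' hy2⟩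

/-! ## The piece P1 from its core S1 -/

/-- **`RobustLoudLowBlocks ⇐ StructuralBlockAtSweepingScale` (S1)**: the birth skeleton of piece P1 with its provable half
discharged — P1 follows from ONE robust loud block per viscosity at the explicit sweeping level (`m := max M m₀`). -/
theorem robustLoudLowBlocks_of_structuralBlock :
    (∃ (mf : ℕ) (f : UnitAddTorus (Fin 3) → EuclideanSpace ℝ (Fin 3)),
      ((IsSmooth f ∧ IsDivFree f ∧ ∀ k : Fin 3 → ℤ, ((mf : ℕ) : ℝ) ^ 2 < freqNormSq k →
          UnitAddTorus.mFourierCoeff (EuclideanSpace.complexify ∘ f) k = 0) ∧ HasZeroMean f) ∧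
      ∃ (E ε₀ ν₀ : ℝ), 0 < ε₀ ∧ 0 < ν₀ ∧ ∀ ν : ℝ, 0 < ν → ν ≤ ν₀ →
        ∃ (A θ δ : ℝ) (G : ℝ≥0), 0 < A ∧ 0 < θ ∧ θ < 1 ∧ 0 < δ ∧ ∃ m₀ : ℕ, mf ≤ m₀ ∧ (10 : ℝ) ^ 5 * A ≤ ν * ((m₀ : ℝ) + 1) ∧ (10 : ℝ) ^ 4 * A ^ 2 * θ ^ (2 * m₀) ≤ δ ∧
          ∃ (n : ℕ) (h : Fin n → (↥(freqBall m₀ : Finset (Fin 3 → ℤ)) → EuclideanSpace ℂ (Fin 3)) → ℝ)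
            (h' : Fin n → (↥(freqBall m₀ : Finset (Fin 3 → ℤ)) → EuclideanSpace ℂ (Fin 3)) →
              ((↥(freqBall m₀ : Finset (Fin 3 → ℤ)) → EuclideanSpace ℂ (Fin 3)) →L[ℝ] ℝ)),
            (∀ i y, HasFDerivAt (h i) (h' i y) y) ∧ (∀ i, Continuous (h' i)) ∧
            (∀ y : ↥(galerkinSubspace (freqBall m₀ : Finset (Fin 3 → ℤ))),
                (∀ i, 0 ≤ h i y) → (∀ k : ↥(freqBall m₀ : Finset (Fin 3 → ℤ)), (k : Fin 3 → ℤ) = 0 →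
                  (y : ↥(freqBall m₀ : Finset (Fin 3 → ℤ)) → EuclideanSpace ℂ (Fin 3)) k = 0) →
                ∀ i, h i y = 0 → ∀ w : ↥(freqBall m₀ : Finset (Fin 3 → ℤ)) → EuclideanSpace ℂ (Fin 3),
                  (∀ k : ↥(freqBall m₀ : Finset (Fin 3 → ℤ)), ‖w k‖ ≤ 2 * (ν * A * θ ^ (max (∑ j, ((k : Fin 3 → ℤ) j).natAbs) m₀) /
                    (1 + ((max (∑ j, ((k : Fin 3 → ℤ) j).natAbs) m₀ : ℕ) : ℝ)) ^ 4)) →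
                  h' i y (galerkinRHS (freqBall m₀ : Finset (Fin 3 → ℤ)) ν (fourierRestrict (freqBall m₀ : Finset (Fin 3 → ℤ)) f) y + w) ≠ 0) ∧
            (¬ ∃ r : ↥(galerkinSubspace (freqBall m₀ : Finset (Fin 3 → ℤ))) → ↥(galerkinSubspace (freqBall m₀ : Finset (Fin 3 → ℤ))),
                ContinuousOn r {y | (∀ i, 0 ≤ h i y) ∧ ∀ k : ↥(freqBall m₀ : Finset (Fin 3 → ℤ)), (k : Fin 3 → ℤ) = 0 →
                  (y : ↥(freqBall m₀ : Finset (Fin 3 → ℤ)) → EuclideanSpace ℂ (Fin 3)) k = 0} ∧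
                MapsTo r {y | (∀ i, 0 ≤ h i y) ∧ ∀ k : ↥(freqBall m₀ : Finset (Fin 3 → ℤ)), (k : Fin 3 → ℤ) = 0 →
                  (y : ↥(freqBall m₀ : Finset (Fin 3 → ℤ)) → EuclideanSpace ℂ (Fin 3)) k = 0}
                  {y | ((∀ i, 0 ≤ h i y) ∧ ∀ k : ↥(freqBall m₀ : Finset (Fin 3 → ℤ)), (k : Fin 3 → ℤ) = 0 →
                    (y : ↥(freqBall m₀ : Finset (Fin 3 → ℤ)) → EuclideanSpace ℂ (Fin 3)) k = 0) ∧
                    ∃ i, h i y = 0 ∧ h' i y (galerkinRHS (freqBall m₀ : Finset (Fin 3 → ℤ)) ν (fourierRestrict (freqBall m₀ : Finset (Fin 3 → ℤ)) f) y) < 0} ∧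
                ∀ y ∈ {y : ↥(galerkinSubspace (freqBall m₀ : Finset (Fin 3 → ℤ))) | ((∀ i, 0 ≤ h i y) ∧ ∀ k : ↥(freqBall m₀ : Finset (Fin 3 → ℤ)), (k : Fin 3 → ℤ) = 0 →
                    (y : ↥(freqBall m₀ : Finset (Fin 3 → ℤ)) → EuclideanSpace ℂ (Fin 3)) k = 0) ∧
                    ∃ i, h i y = 0 ∧ h' i y (galerkinRHS (freqBall m₀ : Finset (Fin 3 → ℤ)) ν (fourierRestrict (freqBall m₀ : Finset (Fin 3 → ℤ)) f) y) < 0},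
                  r y = y) ∧
            (∀ y : ↥(galerkinSubspace (freqBall m₀ : Finset (Fin 3 → ℤ))),
                (∀ i, 0 ≤ h i y) → (∀ k : ↥(freqBall m₀ : Finset (Fin 3 → ℤ)), (k : Fin 3 → ℤ) = 0 →
                  (y : ↥(freqBall m₀ : Finset (Fin 3 → ℤ)) → EuclideanSpace ℂ (Fin 3)) k = 0) →
                (∀ k : ↥(freqBall m₀ : Finset (Fin 3 → ℤ)), ‖(y : ↥(freqBall m₀ : Finset (Fin 3 → ℤ)) → EuclideanSpace ℂ (Fin 3)) k‖ ≤
                    A * θ ^ (∑ i, ((k : Fin 3 → ℤ) i).natAbs) / (1 + ∑ i, (((k : Fin 3 → ℤ) i).natAbs : ℝ)) ^ 6) ∧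
                2⁻¹ * ∑ k, ‖(y : ↥(freqBall m₀ : Finset (Fin 3 → ℤ)) → EuclideanSpace ℂ (Fin 3)) k‖ ^ 2 + 2 * δ ≤ E ∧
                ε₀ ≤ ∑ k, (inner ℂ (fourierRestrict (freqBall m₀ : Finset (Fin 3 → ℤ)) f k)
                  ((y : ↥(freqBall m₀ : Finset (Fin 3 → ℤ)) → EuclideanSpace ℂ (Fin 3)) k)).re ∧
                4 * Real.pi ^ 2 * ∑ k, freqNormSq ((k : ↥(freqBall m₀ : Finset (Fin 3 → ℤ))) : Fin 3 → ℤ) *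
                  ‖(y : ↥(freqBall m₀ : Finset (Fin 3 → ℤ)) → EuclideanSpace ℂ (Fin 3)) k‖ ^ 2 + 2 * δ ≤ (G : ℝ))) →
    (∃ (mf : ℕ) (f : UnitAddTorus (Fin 3) → EuclideanSpace ℝ (Fin 3)),
      ((IsSmooth f ∧ IsDivFree f ∧ ∀ k : Fin 3 → ℤ, ((mf : ℕ) : ℝ) ^ 2 < freqNormSq k →
          UnitAddTorus.mFourierCoeff (EuclideanSpace.complexify ∘ f) k = 0) ∧ HasZeroMean f) ∧
      ∃ (E ε₀ ν₀ : ℝ), 0 < ε₀ ∧ 0 < ν₀ ∧ ∀ ν : ℝ, 0 < ν → ν ≤ ν₀ →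
        ∃ (A θ δ : ℝ) (G : ℝ≥0), 0 < A ∧ 0 < θ ∧ θ < 1 ∧ 0 < δ ∧ ∀ M : ℕ, ∃ m : ℕ, M ≤ m ∧ mf ≤ m ∧
          ∃ (n : ℕ) (h : Fin n → (↥(freqBall m : Finset (Fin 3 → ℤ)) → EuclideanSpace ℂ (Fin 3)) → ℝ)
            (h' : Fin n → (↥(freqBall m : Finset (Fin 3 → ℤ)) → EuclideanSpace ℂ (Fin 3)) →
              ((↥(freqBall m : Finset (Fin 3 → ℤ)) → EuclideanSpace ℂ (Fin 3)) →L[ℝ] ℝ)),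
            (∀ i y, HasFDerivAt (h i) (h' i y) y) ∧ (∀ i, Continuous (h' i)) ∧
            (∀ y : ↥(galerkinSubspace (freqBall m : Finset (Fin 3 → ℤ))),
                (∀ i, 0 ≤ h i y) → (∀ k : ↥(freqBall m : Finset (Fin 3 → ℤ)), (k : Fin 3 → ℤ) = 0 →
                  (y : ↥(freqBall m : Finset (Fin 3 → ℤ)) → EuclideanSpace ℂ (Fin 3)) k = 0) →
                ∀ i, h i y = 0 → ∀ w : ↥(freqBall m : Finset (Fin 3 → ℤ)) → EuclideanSpace ℂ (Fin 3),
                  (∀ k : ↥(freqBall m : Finset (Fin 3 → ℤ)), ‖w k‖ ≤ ν * A * θ ^ (max (∑ j, ((k : Fin 3 → ℤ) j).natAbs) m) /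
                    (1 + ((max (∑ j, ((k : Fin 3 → ℤ) j).natAbs) m : ℕ) : ℝ)) ^ 4) →
                  h' i y (galerkinRHS (freqBall m : Finset (Fin 3 → ℤ)) ν (fourierRestrict (freqBall m : Finset (Fin 3 → ℤ)) f) y + w) ≠ 0) ∧
            (¬ ∃ r : ↥(galerkinSubspace (freqBall m : Finset (Fin 3 → ℤ))) → ↥(galerkinSubspace (freqBall m : Finset (Fin 3 → ℤ))),
                ContinuousOn r {y | (∀ i, 0 ≤ h i y) ∧ ∀ k : ↥(freqBall m : Finset (Fin 3 → ℤ)), (k : Fin 3 → ℤ) = 0 →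
                  (y : ↥(freqBall m : Finset (Fin 3 → ℤ)) → EuclideanSpace ℂ (Fin 3)) k = 0} ∧
                MapsTo r {y | (∀ i, 0 ≤ h i y) ∧ ∀ k : ↥(freqBall m : Finset (Fin 3 → ℤ)), (k : Fin 3 → ℤ) = 0 →
                  (y : ↥(freqBall m : Finset (Fin 3 → ℤ)) → EuclideanSpace ℂ (Fin 3)) k = 0}
                  {y | ((∀ i, 0 ≤ h i y) ∧ ∀ k : ↥(freqBall m : Finset (Fin 3 → ℤ)), (k : Fin 3 → ℤ) = 0 →
                    (y : ↥(freqBall m : Finset (Fin 3 → ℤ)) → EuclideanSpace ℂ (Fin 3)) k = 0) ∧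
                    ∃ i, h i y = 0 ∧ h' i y (galerkinRHS (freqBall m : Finset (Fin 3 → ℤ)) ν (fourierRestrict (freqBall m : Finset (Fin 3 → ℤ)) f) y) < 0} ∧
                ∀ y ∈ {y : ↥(galerkinSubspace (freqBall m : Finset (Fin 3 → ℤ))) | ((∀ i, 0 ≤ h i y) ∧ ∀ k : ↥(freqBall m : Finset (Fin 3 → ℤ)), (k : Fin 3 → ℤ) = 0 →
                    (y : ↥(freqBall m : Finset (Fin 3 → ℤ)) → EuclideanSpace ℂ (Fin 3)) k = 0) ∧
                    ∃ i, h i y = 0 ∧ h' i y (galerkinRHS (freqBall m : Finset (Fin 3 → ℤ)) ν (fourierRestrict (freqBall m : Finset (Fin 3 → ℤ)) f) y) < 0},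
                  r y = y) ∧
            (∀ y : ↥(galerkinSubspace (freqBall m : Finset (Fin 3 → ℤ))),
                (∀ i, 0 ≤ h i y) → (∀ k : ↥(freqBall m : Finset (Fin 3 → ℤ)), (k : Fin 3 → ℤ) = 0 →
                  (y : ↥(freqBall m : Finset (Fin 3 → ℤ)) → EuclideanSpace ℂ (Fin 3)) k = 0) →
                (∀ k : ↥(freqBall m : Finset (Fin 3 → ℤ)), ‖(y : ↥(freqBall m : Finset (Fin 3 → ℤ)) → EuclideanSpace ℂ (Fin 3)) k‖ ≤
                    A * θ ^ (∑ i, ((k : Fin 3 → ℤ) i).natAbs) / (1 + ∑ i, (((k : Fin 3 → ℤ) i).natAbs : ℝ)) ^ 6) ∧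
                2⁻¹ * ∑ k, ‖(y : ↥(freqBall m : Finset (Fin 3 → ℤ)) → EuclideanSpace ℂ (Fin 3)) k‖ ^ 2 + δ ≤ E ∧
                ε₀ ≤ ∑ k, (inner ℂ (fourierRestrict (freqBall m : Finset (Fin 3 → ℤ)) f k)
                  ((y : ↥(freqBall m : Finset (Fin 3 → ℤ)) → EuclideanSpace ℂ (Fin 3)) k)).re ∧
                4 * Real.pi ^ 2 * ∑ k, freqNormSq ((k : ↥(freqBall m : Finset (Fin 3 → ℤ))) : Fin 3 → ℤ) *
                  ‖(y : ↥(freqBall m : Finset (Fin 3 → ℤ)) → EuclideanSpace ℂ (Fin 3)) k‖ ^ 2 + δ ≤ (G : ℝ))) := by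
  rintro ⟨mf, f, hf, E, ε₀, ν₀, hε₀, hν₀, hS1⟩
  refine ⟨mf, f, hf, E, ε₀, ν₀, hε₀, hν₀, fun ν hν hνle => ?_⟩
  obtain ⟨A, θ, δ, G, hA, hθ, hθ1, hδ, m₀, hmf, hsw, htail, hblk⟩ := hS1 ν hν hνle
  refine ⟨A, θ, δ, G, hA, hθ, hθ1, hδ, fun M => ⟨max M m₀, le_max_left _ _, hmf.trans (le_max_right _ _), ?_⟩⟩
  exact stub_boxExtensionUpward ν mf f E ε₀ A θ δ G m₀ hν hA hθ hθ1 hδ hf.1.2.2 hmf hsw htail hblk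
    (max M m₀) (le_max_right _ _)

end Summit.AnomalousDissipation.AnomalousDissipation.Cruxes.UniformGalerkinTrap.RobustLoudLowBlocksBirth


/-! ## §STUBS — birth skeleton of piece P1: the single open stub S1 and the composition -/

namespace Summit.AnomalousDissipation.AnomalousDissipation.Cruxes.UniformGalerkinTrap.RobustLoudLowBlocksBirth

open scoped InnerProductSpace ENNReal NNReal
open MeasureTheory Set Filter Topology
open Literature.Analysis.FunctionSpaces Literature.Analysis.FunctionSpaces.Torus
open Literature.Analysis.FluidPDE

/-- **stub S1 (`StructuralBlockAtSweepingScale`, THE CORE — the only `sorry`).** Per viscosity ONE robust loud polyfacial block of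
the order-`m₀` Galerkin system at the explicit sweeping level. [conjecture-class] -/
theorem stub_structuralBlockAtSweepingScale :
    ∃ (mf : ℕ) (f : UnitAddTorus (Fin 3) → EuclideanSpace ℝ (Fin 3)),
      ((IsSmooth f ∧ IsDivFree f ∧ ∀ k : Fin 3 → ℤ, ((mf : ℕ) : ℝ) ^ 2 < freqNormSq k →
          UnitAddTorus.mFourierCoeff (EuclideanSpace.complexify ∘ f) k = 0) ∧ HasZeroMean f) ∧
      ∃ (E ε₀ ν₀ : ℝ), 0 < ε₀ ∧ 0 < ν₀ ∧ ∀ ν : ℝ, 0 < ν → ν ≤ ν₀ →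
        ∃ (A θ δ : ℝ) (G : ℝ≥0), 0 < A ∧ 0 < θ ∧ θ < 1 ∧ 0 < δ ∧ ∃ m₀ : ℕ, mf ≤ m₀ ∧ (10 : ℝ) ^ 5 * A ≤ ν * ((m₀ : ℝ) + 1) ∧ (10 : ℝ) ^ 4 * A ^ 2 * θ ^ (2 * m₀) ≤ δ ∧
          ∃ (n : ℕ) (h : Fin n → (↥(freqBall m₀ : Finset (Fin 3 → ℤ)) → EuclideanSpace ℂ (Fin 3)) → ℝ)
            (h' : Fin n → (↥(freqBall m₀ : Finset (Fin 3 → ℤ)) → EuclideanSpace ℂ (Fin 3)) →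
              ((↥(freqBall m₀ : Finset (Fin 3 → ℤ)) → EuclideanSpace ℂ (Fin 3)) →L[ℝ] ℝ)),
            (∀ i y, HasFDerivAt (h i) (h' i y) y) ∧ (∀ i, Continuous (h' i)) ∧
            (∀ y : ↥(galerkinSubspace (freqBall m₀ : Finset (Fin 3 → ℤ))),
                (∀ i, 0 ≤ h i y) → (∀ k : ↥(freqBall m₀ : Finset (Fin 3 → ℤ)), (k : Fin 3 → ℤ) = 0 →
                  (y : ↥(freqBall m₀ : Finset (Fin 3 → ℤ)) → EuclideanSpace ℂ (Fin 3)) k = 0) →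
                ∀ i, h i y = 0 → ∀ w : ↥(freqBall m₀ : Finset (Fin 3 → ℤ)) → EuclideanSpace ℂ (Fin 3),
                  (∀ k : ↥(freqBall m₀ : Finset (Fin 3 → ℤ)), ‖w k‖ ≤ 2 * (ν * A * θ ^ (max (∑ j, ((k : Fin 3 → ℤ) j).natAbs) m₀) /
                    (1 + ((max (∑ j, ((k : Fin 3 → ℤ) j).natAbs) m₀ : ℕ) : ℝ)) ^ 4)) →
                  h' i y (galerkinRHS (freqBall m₀ : Finset (Fin 3 → ℤ)) ν (fourierRestrict (freqBall m₀ : Finset (Fin 3 → ℤ)) f) y + w) ≠ 0) ∧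
            (¬ ∃ r : ↥(galerkinSubspace (freqBall m₀ : Finset (Fin 3 → ℤ))) → ↥(galerkinSubspace (freqBall m₀ : Finset (Fin 3 → ℤ))),
                ContinuousOn r {y | (∀ i, 0 ≤ h i y) ∧ ∀ k : ↥(freqBall m₀ : Finset (Fin 3 → ℤ)), (k : Fin 3 → ℤ) = 0 →
                  (y : ↥(freqBall m₀ : Finset (Fin 3 → ℤ)) → EuclideanSpace ℂ (Fin 3)) k = 0} ∧
                MapsTo r {y | (∀ i, 0 ≤ h i y) ∧ ∀ k : ↥(freqBall m₀ : Finset (Fin 3 → ℤ)), (k : Fin 3 → ℤ) = 0 →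
                  (y : ↥(freqBall m₀ : Finset (Fin 3 → ℤ)) → EuclideanSpace ℂ (Fin 3)) k = 0}
                  {y | ((∀ i, 0 ≤ h i y) ∧ ∀ k : ↥(freqBall m₀ : Finset (Fin 3 → ℤ)), (k : Fin 3 → ℤ) = 0 →
                    (y : ↥(freqBall m₀ : Finset (Fin 3 → ℤ)) → EuclideanSpace ℂ (Fin 3)) k = 0) ∧
                    ∃ i, h i y = 0 ∧ h' i y (galerkinRHS (freqBall m₀ : Finset (Fin 3 → ℤ)) ν (fourierRestrict (freqBall m₀ : Finset (Fin 3 → ℤ)) f) y) < 0} ∧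
                ∀ y ∈ {y : ↥(galerkinSubspace (freqBall m₀ : Finset (Fin 3 → ℤ))) | ((∀ i, 0 ≤ h i y) ∧ ∀ k : ↥(freqBall m₀ : Finset (Fin 3 → ℤ)), (k : Fin 3 → ℤ) = 0 →
                    (y : ↥(freqBall m₀ : Finset (Fin 3 → ℤ)) → EuclideanSpace ℂ (Fin 3)) k = 0) ∧
                    ∃ i, h i y = 0 ∧ h' i y (galerkinRHS (freqBall m₀ : Finset (Fin 3 → ℤ)) ν (fourierRestrict (freqBall m₀ : Finset (Fin 3 → ℤ)) f) y) < 0},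
                  r y = y) ∧
            (∀ y : ↥(galerkinSubspace (freqBall m₀ : Finset (Fin 3 → ℤ))),
                (∀ i, 0 ≤ h i y) → (∀ k : ↥(freqBall m₀ : Finset (Fin 3 → ℤ)), (k : Fin 3 → ℤ) = 0 →
                  (y : ↥(freqBall m₀ : Finset (Fin 3 → ℤ)) → EuclideanSpace ℂ (Fin 3)) k = 0) →
                (∀ k : ↥(freqBall m₀ : Finset (Fin 3 → ℤ)), ‖(y : ↥(freqBall m₀ : Finset (Fin 3 → ℤ)) → EuclideanSpace ℂ (Fin 3)) k‖ ≤
                    A * θ ^ (∑ i, ((k : Fin 3 → ℤ) i).natAbs) / (1 + ∑ i, (((k : Fin 3 → ℤ) i).natAbs : ℝ)) ^ 6) ∧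
                2⁻¹ * ∑ k, ‖(y : ↥(freqBall m₀ : Finset (Fin 3 → ℤ)) → EuclideanSpace ℂ (Fin 3)) k‖ ^ 2 + 2 * δ ≤ E ∧
                ε₀ ≤ ∑ k, (inner ℂ (fourierRestrict (freqBall m₀ : Finset (Fin 3 → ℤ)) f k)
                  ((y : ↥(freqBall m₀ : Finset (Fin 3 → ℤ)) → EuclideanSpace ℂ (Fin 3)) k)).re ∧
                4 * Real.pi ^ 2 * ∑ k, freqNormSq ((k : ↥(freqBall m₀ : Finset (Fin 3 → ℤ))) : Fin 3 → ℤ) *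
                  ‖(y : ↥(freqBall m₀ : Finset (Fin 3 → ℤ)) → EuclideanSpace ℂ (Fin 3)) k‖ ^ 2 + 2 * δ ≤ (G : ℝ)) := by
  sorry

/-- **Composition**: piece P1 `RobustLoudLowBlocks` from S1 (S2 `stub_boxExtensionUpward` is PROVED above). -/
theorem robustLoudLowBlocks_of :
    ∃ (mf : ℕ) (f : UnitAddTorus (Fin 3) → EuclideanSpace ℝ (Fin 3)),
      ((IsSmooth f ∧ IsDivFree f ∧ ∀ k : Fin 3 → ℤ, ((mf : ℕ) : ℝ) ^ 2 < freqNormSq k →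
          UnitAddTorus.mFourierCoeff (EuclideanSpace.complexify ∘ f) k = 0) ∧ HasZeroMean f) ∧
      ∃ (E ε₀ ν₀ : ℝ), 0 < ε₀ ∧ 0 < ν₀ ∧ ∀ ν : ℝ, 0 < ν → ν ≤ ν₀ →
        ∃ (A θ δ : ℝ) (G : ℝ≥0), 0 < A ∧ 0 < θ ∧ θ < 1 ∧ 0 < δ ∧ ∀ M : ℕ, ∃ m : ℕ, M ≤ m ∧ mf ≤ m ∧
          ∃ (n : ℕ) (h : Fin n → (↥(freqBall m : Finset (Fin 3 → ℤ)) → EuclideanSpace ℂ (Fin 3)) → ℝ)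
            (h' : Fin n → (↥(freqBall m : Finset (Fin 3 → ℤ)) → EuclideanSpace ℂ (Fin 3)) →
              ((↥(freqBall m : Finset (Fin 3 → ℤ)) → EuclideanSpace ℂ (Fin 3)) →L[ℝ] ℝ)),
            (∀ i y, HasFDerivAt (h i) (h' i y) y) ∧ (∀ i, Continuous (h' i)) ∧
            (∀ y : ↥(galerkinSubspace (freqBall m : Finset (Fin 3 → ℤ))),
                (∀ i, 0 ≤ h i y) → (∀ k : ↥(freqBall m : Finset (Fin 3 → ℤ)), (k : Fin 3 → ℤ) = 0 →
                  (y : ↥(freqBall m : Finset (Fin 3 → ℤ)) → EuclideanSpace ℂ (Fin 3)) k = 0) →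
                ∀ i, h i y = 0 → ∀ w : ↥(freqBall m : Finset (Fin 3 → ℤ)) → EuclideanSpace ℂ (Fin 3),
                  (∀ k : ↥(freqBall m : Finset (Fin 3 → ℤ)), ‖w k‖ ≤ ν * A * θ ^ (max (∑ j, ((k : Fin 3 → ℤ) j).natAbs) m) /
                    (1 + ((max (∑ j, ((k : Fin 3 → ℤ) j).natAbs) m : ℕ) : ℝ)) ^ 4) →
                  h' i y (galerkinRHS (freqBall m : Finset (Fin 3 → ℤ)) ν (fourierRestrict (freqBall m : Finset (Fin 3 → ℤ)) f) y + w) ≠ 0) ∧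
            (¬ ∃ r : ↥(galerkinSubspace (freqBall m : Finset (Fin 3 → ℤ))) → ↥(galerkinSubspace (freqBall m : Finset (Fin 3 → ℤ))),
                ContinuousOn r {y | (∀ i, 0 ≤ h i y) ∧ ∀ k : ↥(freqBall m : Finset (Fin 3 → ℤ)), (k : Fin 3 → ℤ) = 0 →
                  (y : ↥(freqBall m : Finset (Fin 3 → ℤ)) → EuclideanSpace ℂ (Fin 3)) k = 0} ∧
                MapsTo r {y | (∀ i, 0 ≤ h i y) ∧ ∀ k : ↥(freqBall m : Finset (Fin 3 → ℤ)), (k : Fin 3 → ℤ) = 0 →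
                  (y : ↥(freqBall m : Finset (Fin 3 → ℤ)) → EuclideanSpace ℂ (Fin 3)) k = 0}
                  {y | ((∀ i, 0 ≤ h i y) ∧ ∀ k : ↥(freqBall m : Finset (Fin 3 → ℤ)), (k : Fin 3 → ℤ) = 0 →
                    (y : ↥(freqBall m : Finset (Fin 3 → ℤ)) → EuclideanSpace ℂ (Fin 3)) k = 0) ∧
                    ∃ i, h i y = 0 ∧ h' i y (galerkinRHS (freqBall m : Finset (Fin 3 → ℤ)) ν (fourierRestrict (freqBall m : Finset (Fin 3 → ℤ)) f) y) < 0} ∧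
                ∀ y ∈ {y : ↥(galerkinSubspace (freqBall m : Finset (Fin 3 → ℤ))) | ((∀ i, 0 ≤ h i y) ∧ ∀ k : ↥(freqBall m : Finset (Fin 3 → ℤ)), (k : Fin 3 → ℤ) = 0 →
                    (y : ↥(freqBall m : Finset (Fin 3 → ℤ)) → EuclideanSpace ℂ (Fin 3)) k = 0) ∧
                    ∃ i, h i y = 0 ∧ h' i y (galerkinRHS (freqBall m : Finset (Fin 3 → ℤ)) ν (fourierRestrict (freqBall m : Finset (Fin 3 → ℤ)) f) y) < 0},
                  r y = y) ∧
            (∀ y : ↥(galerkinSubspace (freqBall m : Finset (Fin 3 → ℤ))),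
                (∀ i, 0 ≤ h i y) → (∀ k : ↥(freqBall m : Finset (Fin 3 → ℤ)), (k : Fin 3 → ℤ) = 0 →
                  (y : ↥(freqBall m : Finset (Fin 3 → ℤ)) → EuclideanSpace ℂ (Fin 3)) k = 0) →
                (∀ k : ↥(freqBall m : Finset (Fin 3 → ℤ)), ‖(y : ↥(freqBall m : Finset (Fin 3 → ℤ)) → EuclideanSpace ℂ (Fin 3)) k‖ ≤
                    A * θ ^ (∑ i, ((k : Fin 3 → ℤ) i).natAbs) / (1 + ∑ i, (((k : Fin 3 → ℤ) i).natAbs : ℝ)) ^ 6) ∧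
                2⁻¹ * ∑ k, ‖(y : ↥(freqBall m : Finset (Fin 3 → ℤ)) → EuclideanSpace ℂ (Fin 3)) k‖ ^ 2 + δ ≤ E ∧
                ε₀ ≤ ∑ k, (inner ℂ (fourierRestrict (freqBall m : Finset (Fin 3 → ℤ)) f k)
                  ((y : ↥(freqBall m : Finset (Fin 3 → ℤ)) → EuclideanSpace ℂ (Fin 3)) k)).re ∧
                4 * Real.pi ^ 2 * ∑ k, freqNormSq ((k : ↥(freqBall m : Finset (Fin 3 → ℤ))) : Fin 3 → ℤ) *
                  ‖(y : ↥(freqBall m : Finset (Fin 3 → ℤ)) → EuclideanSpace ℂ (Fin 3)) k‖ ^ 2 + δ ≤ (G : ℝ)) :=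
  robustLoudLowBlocks_of_structuralBlock stub_structuralBlockAtSweepingScale

end Summit.AnomalousDissipation.AnomalousDissipation.Cruxes.UniformGalerkinTrap.RobustLoudLowBlocksBirth

end
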